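import Literature.MathematicalPhysics.QuantumFieldTheory.Federbush1986.CorrectedModePlaquetteVariables
import Literature.MathematicalPhysics.QuantumFieldTheory.Federbush1986.LandauModeMultipliers
import Literature.MathematicalPhysics.QuantumFieldTheory.Federbush1986.MomentumCellPoisson
import Mathlib.Analysis.Fourier.FourierTransformDeriv
import Mathlib.MeasureTheory.Group.Prod

/-!
# `Federbush1986.LandauModeWeakEulerLagrange` — [Federbush1986PhaseCellI] §3 p. 327 «we construct a potential, A^N_μ(x), …
# minimizing the continuum action subject to this constraint» / (3.4) «We seek a minimum of the action S … and then take the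
# limit α → ∞. (Alternatively one could use Lagrange multipliers.)» — THE WEAK EULER–LAGRANGE EQUATION OF THE EXPLICIT FIELD
# `A^N = field s` PROVED: the first variation of the continuum action at `A^N` vanishes along every smooth compactly supported
# variation with zero level-0 plaquette variables, hence `S(A^N) ≤ S(A^N + ψ)` for all such `ψ`

statement-level skeleton of published theorems with citation tags; proofs where landed; nothing here is a claim about the Yang–Mills mass gap

CITATION HEADER.  P. Federbush, *A phase cell approach to Yang–Mills theory. I. Modes, lattice-continuum duality*, Commun.
Math. Phys. **107** (1986) 319–329 [Federbush1986PhaseCellI] (p. 327–328 READ AS IMAGES `run/shared/lean/pub/lit-balaban/lit-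
balaban-r17/renders/fedI/fed1986-cmp107-p009|p010-x2.png`); P. Federbush, C. Williamson, *… II. Analysis of a mode*, J. Math.
Phys. **28** (1987) 1416–1419 [FederbushWilliamson1987PhaseCellII]; E. M. Stein, G. Weiss, *Introduction to Fourier Analysis on
Euclidean Spaces* (1971) Ch. VII §2 Thm 2.4 [SteinWeiss1971] (Poisson summation, via `MomentumCellPoisson`).  Unit
`lit-balaban-r17` gen 12 (fold owner of the Federbush block; own lane `Federbush1986/`), SKELETON rows **F1.Eq3.2-3.12** (cell
(3.4): constrained minimality), **F1.Eq3.1** / **F1.Sect§0** (consumer: the hypothesis `hmin` of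
`CorrectedModePlaquetteVariables.modeEstimatesLe_of_field_minimal`), **F2.Eq2.1-2.5**; heads unchanged.  HOME
`run/shared/lean/pub/lit-balaban/`.  Assembles r17 gen 11's `LandauModeMultipliers` (`p²A′_μ = Λ_μ b̂_μ`, `Λ` a lattice
co-boundary), `MomentumCellPoisson` v1.1 (Poisson uniqueness on the momentum cell, `HasInvSqDecay`), `LandauModePlaquetteVariables`
(cell decomposition `integral_eq_integral_cell_tsum`), `CorrectedModePlaquetteVariables` (the field `field s` of p04's corrected
mode), r17 gen 10's `PlaquetteTestFunctionFourier` ((3.10)) and r17 gen 9's `ModeLinearity` (polarisation of the action).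

THE PRINT (verbatim).  I p. 327: *«In this section (and Part II of this paper) we construct a potential, A^N_μ(x), satisfying
Estimates 0.1–0.3, yielding the correct plaquette assignments at level 0, and minimizing the continuum action subject to this
constraint. … We thus have prescribed (χ_p, A) = β_p, p ∈ ℒ⁰. (3.3) We seek a minimum of the action S, for a Landau gauge A′,
a gauge transformation of A. S = ½∫Σ_{i,j}(∂A′_i/∂x_j)² + ½α² Σ_{p∈ℒ⁰}((χ_p, A′) − β_p)², (3.4) and then take the limit α → ∞.
(Alternatively one could use Lagrange multipliers.) … C = D⁻¹ (3.6) [with] Σ_n δ(p − p′ − 2πn) … (3.7)»*; p. 328: *«P̃_a(p) =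
(1/2π)²(i/p_r)(e^{−ip_r} − 1)(i/p_s)(e^{−ip_s} − 1)(i/(p_i²p_j²))(1 − e^{−ip_i})²(1 − e^{−ip_j})² × (p_j i_i − p_i i_j) (3.10) … the
minimizing A′ will satisfy A′ = α²C Σ_γ β_γχ_γ. (3.11) … A^N_μ(x) is the Fourier transform of A(p), where A_i(p) = A′_i(p) +
p_iX(p)»*.  II p. 1417: *«A′_i = (−r_L f̄₁⁻¹ (1/p²))(1/p_i)(16/𝒟) l_i, (2.1) … A^N_i(p) = A′_i(p) + p_iX(p), (2.4)»*.

THE ARGUMENT (ours; print leaves «minimizing … subject to this constraint» / the limit α → ∞ of (3.4) undeveloped).  For a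
competitor `A^N + ψ`, `S(A^N + ψ) = S(A^N) + 2∫Σ_{μ<ν}F_{μν}(A^N)F_{μν}(ψ) + S(ψ)` (`ModeLinearity.toReal_contAction_add`), so it
suffices that the CROSS TERM vanishes when `(χ_q, ψ) = 0` for all `q ∈ ℒ⁰`.  In momentum space (Fubini; `F_{μν}(A^N)(x) =
Re ∫ e^{ip·x} i(p_μĝ_ν − p_νĝ_μ)`, `ĝ = (1/2π)²(A′ + pX_c)`; `∫ e^{ip·x}∂_μψ_ν = −ip_μΨ_ν`) the cross term is
`Re ∫ d⁴p Σ_{μ<ν}(p_μΨ_ν − p_νΨ_μ)(p_μĝ_ν − p_νĝ_μ) = Re ∫ [p²(Ψ·ĝ) − (p·Ψ)(p·ĝ)] = (1/2π)² Re ∫ p²(A′·Ψ)` (Landau gauge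
`p·A′ = 0`: the gauge parts drop) `= (1/2π)² Re ∫ Σ_ν Λ_ν b̂_ν Ψ_ν = −(1/2π)² Re ∫ Σ_a x_a G_a` with `G_a = Σ_μ P̃_{a,μ}Ψ_μ`
(`Λ` is a lattice co-boundary, `P̃_a` the lattice curl of `b̂`); `x_a` is `2π`-periodic, so the cell decomposition gives
`−(1/2π)² Re ∫_cell Σ_a x_a(p) Σ_n G_a(p + 2πn)`, and `Σ_n G_a(p + 2πn) = 0` by Poisson summation because `G_a = ȟ_a`, `h_a(y) =
(χ_a(· − y), ψ)`, whose values at `y = m ∈ ℤ⁴` are the level-0 plaquette variables `(χ_{⟨m,a⟩}, ψ) = 0`.  Every exchange is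
absolutely convergent (`Ψ_ν` decays like `(1 + |p|²)⁻⁴`; `p_νĝ_μ ∈ L¹`; the pointwise identities hold off the null set of lattice
hyperplanes).

WHAT IS PROVED (kernel-checked; `def`s with bodies; no `Prop`-valued definition, no named fact, no `sorry`).
* §1 test fields `ψ ∈ C_c^∞`: `cpt`, `tfT` (`Ψ_ν = ∫e^{ip·y}ψ_ν`); **`hatE_pd`** (`∫e^{ip·x}∂_μψ_ν = −ip_μΨ_ν`, Mathlib's
  `Real.fourier_fderiv`), **`tfT_isotropic_decay`** (`|Ψ_ν(p)| ≤ C(1 + Σp_k²)⁻⁴`, Mathlib's `Real.pow_mul_norm_iteratedFDeriv_fourier_le`),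
  `tfT_invSqDecay`.
* §2 the translated plaquette pairing `pairT ψ a y = ∫χ_a(z)·ψ(z + y)`: `plaqTestField_base_add` (translation), **`pairT_latPt`**
  (`h_a(m) = (χ_{⟨m,a⟩}, ψ)`), `continuous_pairT`, `hasCompactSupport_pairT`, `chiHat`/`chiHat_eq_fourierFactor` ((3.10)),
  **`hatE_pairTC`** (`ȟ_a = Σ_μ χ̂_{a,μ}Ψ_μ`, Fubini after the shear `(z,y) ↦ (z, z+y)`), `invSqDecay_hatE_pairTC`,
  **`perSum_hatE_pairTC_eq_zero`** / `perSum_plaqSide_eq_zero` (Poisson: `Σ_n G_a(p + 2πn) = 0` for constraint-preserving `ψ`).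
* §3 **`sum_Lam_bondFactor_eq`**: `Σ_ν Λ_ν b̂_ν Ψ_ν = −Σ_a x_a G_a` pointwise off the lattice hyperplanes; `xLam_shift`.
* §4 `integral_ofReal_mul_modeFT` (Fubini: real `L¹` weight against `∫e^{ip·x}F`).
* §5 the mode: `ghat` (`field s = modeField ghat`), `ghat_pack` (II Thms 3.2–3.3 shape), `integrable_coord_mul_ghat`, `FNhatC`,
  **`fieldStrength_field_eq`** (`F_{μν}(A^N) = Re ∫e^{ip·x}F̂_{μν}`), `integral_mul_fieldStrength_field`.
* §6 **`hatE_fieldStrength`**, `crossIntegrand`, **`integral_crossDensity_eq`** (cross term in momentum space),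
  **`crossIntegrand_eq_Wfun`** (the multiplier identity a.e.), `tsum_Wfun_shiftR_eq_zero`, and
  **`integral_crossDensity_field_eq_zero`: `∫Σ_{μ<ν}F_{μν}(A^N)F_{μν}(ψ) = 0`** for every smooth compactly supported `ψ` with all
  level-0 plaquette variables zero.
* §7 `contAction_ne_top_of_decay313to315` (a (3.13)–(3.15) field has finite action), `contAction_field_ne_top`,
  **`toReal_contAction_field_add`** (`S(A^N + ψ) = S(A^N) + S(ψ)`), **`contAction_field_le_add_test`** (`S(A^N) ≤ S(A^N + ψ)`) and
  **`contAction_field_le_of_plaq_eq`** (the same from equality of the level-0 plaquette variables of `A^N + ψ` and `A^N` in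
  `axialTreeAveraging` — the hypothesis `hmin` of `modeEstimatesLe_of_field_minimal` RESTRICTED to competitors `A^N + ψ`, `ψ ∈ C_c^∞`).

HONEST SCOPE.  (a) Print's (3.4) minimises `½∫Σ(∂_jA′_i)²` over Landau-gauge fields with a penalty and `α → ∞`; the tree's
`contAction` is the gauge-invariant `∫Σ_{μ<ν}F_{μν}²` and `IsConstrainedMinimizer` the exact constraint — this file proves the
first-order (Euler–Lagrange) condition of THAT problem at the explicit field, in the direction print indicates («Lagrange
multipliers»); the multipliers are the `Λ`/`x_a` of `LandauModeMultipliers`, never evaluated individually.  (b) NOT proved: the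
inequality against a GENERAL `C¹` competitor with the same level-0 plaquette variables (the full `hmin`): a competitor difference
need not be compactly supported, smooth, or decaying (it is controlled only through its field strength, up to gauge); the passage
from test variations to general competitors (gauge fixing of the difference + cut-off + mollification + Stokes for the plaquette
functionals) is the remaining step — nothing is claimed about it.  (c) The mode is p04's corrected-gauge mode (`gcorr`, `X_c`);
the cross term is gauge-independent (`p·A′ = 0` kills every `pX` part) and so is `Wfun` (independent of `s`).  (d) The pointwise
identities are used off the null set `{∃k, p_k ∈ 2πℤ}` only.  Axioms standard.
-/

namespace Literature.MathematicalPhysics.QuantumFieldTheory.Federbush1986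

noncomputable section

open Complex ModeAnalyticity Filter Topology MeasureTheory Set
open scoped BigOperators ComplexConjugate FourierTransform RealInnerProductSpace ContDiff

namespace PlaquetteGram

open ModeDecay (toC phase modeFT modeField)

/-! ## §1 Test variations `ψ ∈ C_c^∞(ℝ⁴; ℝ⁴)`: components, transforms `Ψ_ν(p) = ∫ e^{ip·y} ψ_ν(y) d⁴y`, decay -/

/-- The `ν`-th component of a test field as a complex-valued function on `ℝ⁴`. [cite: Federbush1986PhaseCellI, (3.3)–(3.4) p. 327] -/
def cpt (ψ : E4 → Fin 4 → ℝ) (ν : Fin 4) : E4 → ℂ := fun y => ((ψ y ν : ℝ) : ℂ)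

/-- `Ψ_ν(p) = ∫ e^{ip·y} ψ_ν(y) d⁴y` (the tree's `hatE` of the component; kernel `e^{+ip·y}` as in `ModeDecay.modeFT`).
[cite: Federbush1986PhaseCellI, (3.6)–(3.7) p. 327, (3.12) p. 328] -/
def tfT (ψ : E4 → Fin 4 → ℝ) (ν : Fin 4) (p : Fin 4 → ℝ) : ℂ := hatE (cpt ψ ν) p

variable {ψ : E4 → Fin 4 → ℝ}

/-- Components of a smooth test field are smooth. [cite: Federbush1986PhaseCellI, (3.4) p. 327] -/
theorem contDiff_apply_cpt (hψ : ContDiff ℝ ∞ ψ) (ν : Fin 4) : ContDiff ℝ ∞ fun y => ψ y ν := contDiff_pi.1 hψ ν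

/-- Components of a compactly supported test field are compactly supported. [cite: Federbush1986PhaseCellI, (3.4) p. 327] -/
theorem hasCompactSupport_apply (hsupp : HasCompactSupport ψ) (ν : Fin 4) : HasCompactSupport fun y => ψ y ν :=
  hsupp.comp_left (g := fun v : Fin 4 → ℝ => v ν) rfl

/-- The complex component is smooth. [cite: Federbush1986PhaseCellI, (3.4) p. 327] -/
theorem contDiff_cpt (hψ : ContDiff ℝ ∞ ψ) (ν : Fin 4) : ContDiff ℝ ∞ (cpt ψ ν) :=
  Complex.ofRealCLM.contDiff.comp (contDiff_apply_cpt hψ ν)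

/-- The complex component is compactly supported. [cite: Federbush1986PhaseCellI, (3.4) p. 327] -/
theorem hasCompactSupport_cpt (hsupp : HasCompactSupport ψ) (ν : Fin 4) : HasCompactSupport (cpt ψ ν) :=
  (hasCompactSupport_apply hsupp ν).comp_left (g := fun t : ℝ => (t : ℂ)) Complex.ofReal_zero

/-- The complex component is integrable. [cite: Federbush1986PhaseCellI, (3.4) p. 327] -/
theorem integrable_cpt (hψ : ContDiff ℝ ∞ ψ) (hsupp : HasCompactSupport ψ) (ν : Fin 4) : Integrable (cpt ψ ν) :=
  (contDiff_cpt hψ ν).continuous.integrable_of_hasCompactSupport (hasCompactSupport_cpt hsupp ν)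

/-- `∂_μψ_ν` is continuous. [cite: Federbush1986PhaseCellI, (3.4) p. 327] -/
theorem continuous_pd (hψ : ContDiff ℝ ∞ ψ) (μ ν : Fin 4) : Continuous fun x => pd ψ μ ν x := by
  unfold pd
  exact ((contDiff_apply_cpt hψ ν).continuous_fderiv (by simp)).clm_apply continuous_const

/-- `∂_μψ_ν` is compactly supported. [cite: Federbush1986PhaseCellI, (3.4) p. 327] -/
theorem hasCompactSupport_pd (hsupp : HasCompactSupport ψ) (μ ν : Fin 4) : HasCompactSupport fun x => pd ψ μ ν x := by
  unfold pd
  exact ((hasCompactSupport_apply hsupp ν).fderiv (𝕜 := ℝ)).comp_left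
    (g := fun L : E4 →L[ℝ] ℝ => L (unitVec μ)) rfl

/-- The Fréchet derivative of the complex component evaluated at `e_μ` is `∂_μψ_ν`. [cite: Federbush1986PhaseCellI, (3.4) p. 327] -/
theorem fderiv_cpt_unitVec (hψ : ContDiff ℝ ∞ ψ) (μ ν : Fin 4) (x : E4) :
    fderiv ℝ (cpt ψ ν) x (unitVec μ) = ((pd ψ μ ν x : ℝ) : ℂ) := by
  have hd : DifferentiableAt ℝ (fun y => ψ y ν) x :=
    ((contDiff_apply_cpt hψ ν).differentiable (by simp)).differentiableAt
  have h := (Complex.ofRealCLM.hasFDerivAt.comp x hd.hasFDerivAt).fderiv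
  rw [show cpt ψ ν = (Complex.ofRealCLM : ℝ → ℂ) ∘ fun y => ψ y ν from rfl, h]
  rfl

/-- `⟪c·p, e_μ⟫ = c p_μ` on `ℝ⁴`. [folklore] -/
private theorem inner_smul_toE4_unitVec (c : ℝ) (p : Fin 4 → ℝ) (μ : Fin 4) :
    ⟪(c • toE4 p : E4), (unitVec μ : E4)⟫ = c * p μ := by
  rw [unitVec, EuclideanSpace.inner_single_right]
  simp [toE4]

/-- **The transform of a derivative: `∫ e^{ip·x} ∂_μψ_ν(x) d⁴x = −i p_μ Ψ_ν(p)`** (integration by parts; Mathlib's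
`Real.fourier_fderiv` in the tree's kernel convention). [cite: Federbush1986PhaseCellI, (3.4)–(3.6) p. 327] -/
theorem hatE_pd (hψ : ContDiff ℝ ∞ ψ) (hsupp : HasCompactSupport ψ) (μ ν : Fin 4) (p : Fin 4 → ℝ) :
    hatE (fun x => ((pd ψ μ ν x : ℝ) : ℂ)) p = -I * (p μ : ℂ) * tfT ψ ν p := by
  have hfc : ContDiff ℝ ∞ (cpt ψ ν) := contDiff_cpt hψ ν
  have hfi : Integrable (cpt ψ ν) := integrable_cpt hψ hsupp ν
  have hfd : Differentiable ℝ (cpt ψ ν) := hfc.differentiable (by simp)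
  have hf'c : Continuous (fderiv ℝ (cpt ψ ν)) := hfc.continuous_fderiv (by simp)
  have hf'i : Integrable (fderiv ℝ (cpt ψ ν)) :=
    hf'c.integrable_of_hasCompactSupport ((hasCompactSupport_cpt hsupp ν).fderiv (𝕜 := ℝ))
  have key := Real.fourier_fderiv hfi hfd hf'i
  have hfun : (fun x => ((pd ψ μ ν x : ℝ) : ℂ)) = fun x => fderiv ℝ (cpt ψ ν) x (unitVec μ) :=
    funext fun x => (fderiv_cpt_unitVec hψ μ ν x).symm
  rw [hfun, hatE_eq_fourier, ← Real.fourier_continuousLinearMap_apply hf'i, key, VectorFourier.fourierSMulRight_apply,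
    tfT, hatE_eq_fourier]
  have hL : ∀ w : E4, ((-innerSL ℝ) w) (unitVec μ : E4) = -⟪w, (unitVec μ : E4)⟫ := fun w => by
    rw [neg_apply, neg_apply, innerSL_apply_apply]
  rw [hL, inner_smul_toE4_unitVec]
  simp only [smul_eq_mul, Complex.real_smul]
  push_cast
  field_simp


/-- `‖p‖² = Σ_k p_k²` for the Euclidean point with coordinates `p`. [folklore] -/
private theorem norm_toE4_sq (p : Fin 4 → ℝ) : ‖toE4 p‖ ^ 2 = ∑ k, (p k) ^ 2 := by
  rw [EuclideanSpace.norm_sq_eq]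
  exact Finset.sum_congr rfl fun k _ => by simp

/-- **Isotropic decay of the transform of a smooth compactly supported component**: `|Ψ_ν(p)| ≤ C (1 + Σ_k p_k²)⁻⁴`
(moments of `𝓕ψ_ν` from `L¹` norms of derivatives of `ψ_ν` up to order 8, Mathlib's
`Real.pow_mul_norm_iteratedFDeriv_fourier_le`). [cite: FederbushWilliamson1987PhaseCellII, (6.8) p. 1418] -/
theorem tfT_isotropic_decay (hψ : ContDiff ℝ ∞ ψ) (hsupp : HasCompactSupport ψ) (ν : Fin 4) :
    ∃ C, 0 ≤ C ∧ ∀ p, ‖tfT ψ ν p‖ ≤ C * ((1 + ∑ k, (p k) ^ 2) ^ 4)⁻¹ := by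
  have hfc : ContDiff ℝ ∞ (cpt ψ ν) := contDiff_cpt hψ ν
  have hint : ∀ (k n : ℕ), (k : ℕ∞) ≤ 0 → (n : ℕ∞) ≤ (⊤ : ℕ∞) →
      Integrable (fun v : E4 => ‖v‖ ^ k * ‖iteratedFDeriv ℝ n (cpt ψ ν) v‖) := by
    intro k n _ _
    have hcn : ContDiff ℝ n (cpt ψ ν) := hfc.of_le (by exact_mod_cast le_top)
    have hc : Continuous fun v : E4 => ‖v‖ ^ k * ‖iteratedFDeriv ℝ n (cpt ψ ν) v‖ :=
      (continuous_norm.pow k).mul hcn.continuous_iteratedFDeriv'.norm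
    have hs : HasCompactSupport fun v : E4 => ‖v‖ ^ k * ‖iteratedFDeriv ℝ n (cpt ψ ν) v‖ :=
      (((hasCompactSupport_cpt hsupp ν).iteratedFDeriv n).norm).mul_left
    exact hc.integrable_of_hasCompactSupport hs
  set B : ℕ → ℝ := fun n => (2 * Real.pi) ^ 0 * (2 * 0 + 2) ^ n *
      ∑ q ∈ Finset.range (0 + 1) ×ˢ Finset.range (n + 1), ∫ v, ‖v‖ ^ q.1 * ‖iteratedFDeriv ℝ q.2 (cpt ψ ν) v‖ with hB
  have hBw : ∀ (n : ℕ) (w : E4), ‖w‖ ^ n * ‖𝓕 (cpt ψ ν) w‖ ≤ B n := by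
    intro n w
    have h := Real.pow_mul_norm_iteratedFDeriv_fourier_le (K := 0) (N := (⊤ : ℕ∞)) hfc hint (k := 0) (n := n)
      le_rfl le_top w
    rw [norm_iteratedFDeriv_zero] at h
    exact h.trans (le_of_eq (by simp [hB]))
  have hBnn : ∀ n, 0 ≤ B n := fun n => le_trans (by positivity) (hBw n 0)
  set C : ℝ := (2 * Real.pi) ^ 8 * (B 0 + 4 * B 2 + 6 * B 4 + 4 * B 6 + B 8) with hC
  have hCnn : 0 ≤ C := by
    have := hBnn 0; have := hBnn 2; have := hBnn 4; have := hBnn 6; have := hBnn 8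
    positivity
  refine ⟨C, hCnn, fun p => ?_⟩
  set w : E4 := ((-(1 / (2 * Real.pi))) : ℝ) • toE4 p with hw_def
  have hF : tfT ψ ν p = 𝓕 (cpt ψ ν) w := hatE_eq_fourier _ _
  have hw' : ‖w‖ ^ 2 = (1 / (2 * Real.pi)) ^ 2 * ∑ k, (p k) ^ 2 := by
    rw [hw_def, norm_smul, mul_pow, norm_toE4_sq p, Real.norm_eq_abs, abs_neg, abs_of_pos (by positivity)]
  have hw : ∑ k, (p k) ^ 2 = (2 * Real.pi) ^ 2 * ‖w‖ ^ 2 := by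
    rw [hw']; field_simp
  have hπ1 : (1 : ℝ) ≤ (2 * Real.pi) ^ 2 := by nlinarith [Real.pi_gt_three]
  have hu : 0 ≤ ‖w‖ ^ 2 := by positivity
  have key : (1 + ∑ k, (p k) ^ 2) ^ 4 * ‖𝓕 (cpt ψ ν) w‖ ≤ C := by
    rw [hw]
    have hab : 1 + (2 * Real.pi) ^ 2 * ‖w‖ ^ 2 ≤ (2 * Real.pi) ^ 2 * (1 + ‖w‖ ^ 2) := by nlinarith
    have h1 : (1 + (2 * Real.pi) ^ 2 * ‖w‖ ^ 2) ^ 4 ≤ ((2 * Real.pi) ^ 2 * (1 + ‖w‖ ^ 2)) ^ 4 :=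
      pow_le_pow_left₀ (by positivity) hab 4
    have h2 : (1 + ‖w‖ ^ 2) ^ 4 * ‖𝓕 (cpt ψ ν) w‖
        = ‖w‖ ^ 0 * ‖𝓕 (cpt ψ ν) w‖ + 4 * (‖w‖ ^ 2 * ‖𝓕 (cpt ψ ν) w‖) + 6 * (‖w‖ ^ 4 * ‖𝓕 (cpt ψ ν) w‖)
          + 4 * (‖w‖ ^ 6 * ‖𝓕 (cpt ψ ν) w‖) + ‖w‖ ^ 8 * ‖𝓕 (cpt ψ ν) w‖ := by ring
    calc (1 + (2 * Real.pi) ^ 2 * ‖w‖ ^ 2) ^ 4 * ‖𝓕 (cpt ψ ν) w‖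
        ≤ ((2 * Real.pi) ^ 2 * (1 + ‖w‖ ^ 2)) ^ 4 * ‖𝓕 (cpt ψ ν) w‖ :=
          mul_le_mul_of_nonneg_right h1 (norm_nonneg _)
      _ = (2 * Real.pi) ^ 8 * ((1 + ‖w‖ ^ 2) ^ 4 * ‖𝓕 (cpt ψ ν) w‖) := by ring
      _ ≤ (2 * Real.pi) ^ 8 * (B 0 + 4 * B 2 + 6 * B 4 + 4 * B 6 + B 8) := by
          apply mul_le_mul_of_nonneg_left _ (by positivity)
          rw [h2]
          linarith [hBw 0 w, hBw 2 w, hBw 4 w, hBw 6 w, hBw 8 w]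
  have hpos : 0 < (1 + ∑ k, (p k) ^ 2) ^ 4 := by positivity
  rw [hF]
  calc ‖𝓕 (cpt ψ ν) w‖ = ((1 + ∑ k, (p k) ^ 2) ^ 4)⁻¹ * ((1 + ∑ k, (p k) ^ 2) ^ 4 * ‖𝓕 (cpt ψ ν) w‖) := by
        field_simp
    _ ≤ ((1 + ∑ k, (p k) ^ 2) ^ 4)⁻¹ * C := mul_le_mul_of_nonneg_left key (by positivity)
    _ = C * ((1 + ∑ k, (p k) ^ 2) ^ 4)⁻¹ := mul_comm _ _

/-- `Ψ_ν` has inverse-square product decay (the class of `MomentumCellPoisson` §6). [cite: FederbushWilliamson1987PhaseCellII, (6.8) p. 1418] -/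
theorem tfT_invSqDecay (hψ : ContDiff ℝ ∞ ψ) (hsupp : HasCompactSupport ψ) (ν : Fin 4) :
    ∃ C, HasInvSqDecay (tfT ψ ν) C := by
  obtain ⟨C, hC, h⟩ := tfT_isotropic_decay hψ hsupp ν
  exact ⟨C, HasInvSqDecay.of_isotropic hC h⟩

/-- `Ψ_ν` is continuous. [cite: Federbush1986PhaseCellI, (3.6)–(3.7) p. 327] -/
theorem continuous_tfT (hψ : ContDiff ℝ ∞ ψ) (hsupp : HasCompactSupport ψ) (ν : Fin 4) : Continuous (tfT ψ ν) :=
  continuous_hatE (integrable_cpt hψ hsupp ν)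

/-- `Ψ_ν` is bounded by the `L¹` norm of `ψ_ν`. [cite: Federbush1986PhaseCellI, (3.6)–(3.7) p. 327] -/
theorem norm_tfT_le (ν : Fin 4) (p : Fin 4 → ℝ) : ‖tfT ψ ν p‖ ≤ ∫ y, ‖cpt ψ ν y‖ := by
  unfold tfT hatE
  refine (norm_integral_le_integral_norm _).trans (le_of_eq (integral_congr_ae (ae_of_all _ fun y => ?_)))
  dsimp only
  rw [norm_mul, show I * ∑ k, (p k : ℂ) * ((y k : ℝ) : ℂ) = ((∑ k, p k * y k : ℝ) : ℂ) * I by push_cast; ring,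
    Complex.norm_exp_ofReal_mul_I, one_mul]

/-! ## §2 The translated plaquette pairing `h_a(y) = (χ_a(· − y), ψ)` and its transform -/

/-- The level-0 plaquette at the origin with oriented axes `a = (i, j)`. [cite: Federbush1986PhaseCellI, (3.3) p. 327, (3.9) p. 328] -/
def plaq0 (a : Fin 6) : Plaq 0 := ⟨0, (axisPair a).1, (axisPair a).2⟩

/-- The level-0 plaquette with lower-left corner `m ∈ ℤ⁴` and oriented axes `a`. [cite: Federbush1986PhaseCellI, (3.3) p. 327] -/
def plaqAt (m : Fin 4 → ℤ) (a : Fin 6) : Plaq 0 := ⟨m, (axisPair a).1, (axisPair a).2⟩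

/-- The lattice point `m ∈ ℤ⁴ ⊂ ℝ⁴`. [cite: Federbush1986PhaseCellI, §1 p. 321] -/
def latPt (m : Fin 4 → ℤ) : E4 := toE4 fun k => (m k : ℝ)

/-- At level 0 the base vertex of the edge `(m, d)` is the lattice point `m`. [cite: Federbush1986PhaseCellI, §1 p. 321] -/
theorem edge_src_zero (m : Fin 4 → ℤ) (d : Fin 4) : (⟨m, d⟩ : Edge 0).src = latPt m := by
  simp [Edge.src, latPt, mkPt, toE4, latLen]

/-- Translating the base of an edge translates its weight. [cite: Federbush1986PhaseCellI, (2.1)–(2.2) p. 325] -/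
theorem bondWeight_base_add {r : ℕ} (b m : Fin 4 → ℤ) (d : Fin 4) (z : E4) :
    bondWeight (⟨b + m, d⟩ : Edge r) z = bondWeight (⟨b, d⟩ : Edge r) (z - (⟨m, d⟩ : Edge r).src) := by
  simp only [bondWeight_apply]
  congr 1
  have : cubeCoord r (⟨b + m, d⟩ : Edge r).src z = cubeCoord r (⟨b, d⟩ : Edge r).src (z - (⟨m, d⟩ : Edge r).src) := by
    funext k
    simp only [cubeCoord_apply, Edge.src, mkPt, Pi.add_apply, Int.cast_add, PiLp.sub_apply]
    ring
  rw [this]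

/-- **Translating a plaquette translates its test function**: `χ_{⟨b+m, a⟩}(z) = χ_{⟨b, a⟩}(z − m)` (level 0: `m` itself).
[cite: Federbush1986PhaseCellI, (1.13)–(1.14) p. 324, (3.12) p. 328 («γ is the translate by vector ŷ of the element a»)] -/
theorem plaqTestField_base_add {r : ℕ} (b m : Fin 4 → ℤ) (i j : Fin 4) (z : E4) (μ : Fin 4) :
    plaqTestField (⟨b + m, i, j⟩ : Plaq r) z μ = plaqTestField (⟨b, i, j⟩ : Plaq r) (z - (⟨m, i⟩ : Edge r).src) μ := by
  have hsrc : ∀ d : Fin 4, (⟨m, d⟩ : Edge r).src = (⟨m, i⟩ : Edge r).src := fun d => rfl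
  simp only [plaqTestField_apply]
  rw [show b + m + Pi.single i 1 = (b + Pi.single i 1) + m by abel,
    show b + m + Pi.single j 1 = (b + Pi.single j 1) + m by abel,
    bondWeight_base_add b m i z, bondWeight_base_add (b + Pi.single j 1) m i z,
    bondWeight_base_add (b + Pi.single i 1) m j z, bondWeight_base_add b m j z, hsrc j]

/-- **The translated plaquette pairing** `h_a(y) = ∫ d⁴z χ_a(z)·ψ(z + y) = (χ_a(· − y), ψ)` of a test field with the
test function of the origin plaquette of axes `a`; at `y = m ∈ ℤ⁴` it is the level-0 plaquette variable `(χ_{⟨m,a⟩}, ψ)`.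
[cite: Federbush1986PhaseCellI, (3.3) p. 327, (3.6)–(3.7) p. 327] -/
def pairT (ψ : E4 → Fin 4 → ℝ) (a : Fin 6) (y : E4) : ℝ := ∫ z, ∑ μ, plaqTestField (plaq0 a) z μ * ψ (z + y) μ

/-- The translated pairing as a complex function (for `hatE`). [cite: Federbush1986PhaseCellI, (3.6)–(3.7) p. 327] -/
def pairTC (ψ : E4 → Fin 4 → ℝ) (a : Fin 6) : E4 → ℂ := fun y => ((pairT ψ a y : ℝ) : ℂ)

/-- **At a lattice point the translated pairing is the level-0 plaquette variable**: `h_a(m) = (χ_{⟨m,a⟩}, ψ)`.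
[cite: Federbush1986PhaseCellI, (3.3) p. 327, (1.13)–(1.14) p. 324] -/
theorem pairT_latPt (hcont : Continuous ψ) (a : Fin 6) (m : Fin 4 → ℤ) :
    pairT ψ a (latPt m) = plaqFunctional 0 ψ (plaqAt m a) := by
  rw [plaqFunctional_eq_integral_plaqTestField hcont]
  unfold pairT
  have h := integral_add_right_eq_self (μ := (volume : Measure E4))
    (fun w => ∑ μ, plaqTestField (plaqAt m a) w μ * ψ w μ) (latPt m)
  rw [← h]
  refine integral_congr_ae (ae_of_all _ fun z => Finset.sum_congr rfl fun μ _ => ?_)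
  congr 1
  symm
  rw [show plaqAt m a = (⟨0 + m, (axisPair a).1, (axisPair a).2⟩ : Plaq 0) by simp [plaqAt],
    plaqTestField_base_add 0 m _ _ (z + latPt m) μ, edge_src_zero, add_sub_cancel_right]
  rfl

/-- The origin plaquette's test function is supported in the ball of radius 4 (`[0,2]⁴`). [cite: Federbush1986PhaseCellI, (3.9) p. 328] -/
theorem plaqTestField_plaq0_eq_zero {a : Fin 6} {z : E4} (hz : 4 < ‖z‖) (μ : Fin 4) : plaqTestField (plaq0 a) z μ = 0 := by
  refine plaqTestField_eq_zero_of_not_mem (plaq0 a) (fun hmem => ?_) μ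
  have hsrc : (plaq0 a).src = 0 := by simp [plaq0, Plaq.src, mkPt]; rfl
  have hc : ∀ k, cubeCoord 0 (plaq0 a).src z k = z k := fun k => by simp [cubeCoord_apply, hsrc, latLen]
  have hk : ∀ k, (z k) ^ 2 ≤ 4 := fun k => by
    have h1 := hmem.1 k; have h2 := hmem.2 k
    rw [hc k] at h1 h2
    simp only [Pi.ofNat_apply] at h1 h2
    nlinarith
  have hn : ‖z‖ ^ 2 ≤ 16 := by
    rw [EuclideanSpace.norm_sq_eq]
    calc ∑ k, ‖z k‖ ^ 2 ≤ ∑ _k : Fin 4, (4 : ℝ) := Finset.sum_le_sum fun k _ => by rw [Real.norm_eq_abs, sq_abs]; exact hk k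
      _ = 16 := by simp; norm_num
  nlinarith [norm_nonneg z]

/-- A continuous compactly supported test field is bounded. [folklore] -/
private theorem exists_bound (hcont : Continuous ψ) (hsupp : HasCompactSupport ψ) : ∃ B, 0 ≤ B ∧ ∀ y μ, |ψ y μ| ≤ B := by
  obtain ⟨B, hB⟩ := hsupp.exists_bound_of_continuous hcont
  refine ⟨max B 0, le_max_right _ _, fun y μ => ?_⟩
  have h := (norm_le_pi_norm (ψ y) μ).trans (hB y)
  rw [Real.norm_eq_abs] at h
  exact h.trans (le_max_left _ _)

/-- **The translated pairing is continuous** (dominated convergence: `χ_a ∈ L¹`, `ψ` bounded continuous).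
[cite: Federbush1986PhaseCellI, (3.3) p. 327] -/
theorem continuous_pairT (hcont : Continuous ψ) (hsupp : HasCompactSupport ψ) (a : Fin 6) : Continuous (pairT ψ a) := by
  obtain ⟨B, hB0, hB⟩ := exists_bound hcont hsupp
  unfold pairT
  refine continuous_of_dominated (bound := fun z => ∑ μ, |plaqTestField (plaq0 a) z μ| * B) (fun y => ?_)
    (fun y => ae_of_all _ fun z => ?_) ?_ (ae_of_all _ fun z => ?_)
  · exact (integrable_sum_plaqTestField_mul (hcont.comp (continuous_add_const y)) (plaq0 a)).aestronglyMeasurable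
  · rw [Real.norm_eq_abs]
    refine (Finset.abs_sum_le_sum_abs _ _).trans (Finset.sum_le_sum fun μ _ => ?_)
    rw [abs_mul]
    exact mul_le_mul_of_nonneg_left (hB _ _) (abs_nonneg _)
  · exact integrable_finsetSum _ fun μ _ => (integrable_plaqTestField (plaq0 a) μ).abs.mul_const B
  · exact continuous_finsetSum _ fun μ _ =>
      continuous_const.mul ((continuous_apply μ).comp (hcont.comp (continuous_const_add z)))

/-- **The translated pairing is compactly supported** (`χ_a` lives in `[0,2]⁴`, `ψ` in a ball).
[cite: Federbush1986PhaseCellI, (3.3) p. 327, (3.9) p. 328] -/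
theorem hasCompactSupport_pairT (hsupp : HasCompactSupport ψ) (a : Fin 6) : HasCompactSupport (pairT ψ a) := by
  obtain ⟨R, hR⟩ := (hsupp.isCompact.isBounded).subset_closedBall 0
  refine HasCompactSupport.intro (isCompact_closedBall (0 : E4) (R + 4)) fun y hy => ?_
  rw [Metric.mem_closedBall, dist_zero_right, not_le] at hy
  unfold pairT
  refine (integral_congr_ae (ae_of_all _ fun z => ?_)).trans (integral_zero _ _)
  refine Finset.sum_eq_zero fun μ _ => ?_
  by_cases hz : 4 < ‖z‖
  · rw [plaqTestField_plaq0_eq_zero hz, zero_mul]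
  · have hzy : ψ (z + y) = 0 := by
      apply image_eq_zero_of_notMem_tsupport
      intro hmem
      have h := hR hmem
      rw [Metric.mem_closedBall, dist_zero_right] at h
      have : ‖y‖ ≤ ‖z + y‖ + ‖z‖ := by
        have := norm_sub_le (z + y) z; rwa [add_sub_cancel_left] at this
      linarith [not_lt.mp hz]
    rw [hzy, Pi.zero_apply, mul_zero]

/-- `pairTC` is continuous. [cite: Federbush1986PhaseCellI, (3.3) p. 327] -/
theorem continuous_pairTC (hcont : Continuous ψ) (hsupp : HasCompactSupport ψ) (a : Fin 6) : Continuous (pairTC ψ a) :=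
  continuous_ofReal.comp (continuous_pairT hcont hsupp a)

/-- `pairTC` is integrable. [cite: Federbush1986PhaseCellI, (3.3) p. 327] -/
theorem integrable_pairTC (hcont : Continuous ψ) (hsupp : HasCompactSupport ψ) (a : Fin 6) : Integrable (pairTC ψ a) :=
  (continuous_pairTC hcont hsupp a).integrable_of_hasCompactSupport
    ((hasCompactSupport_pairT hsupp a).comp_left (g := fun t : ℝ => (t : ℂ)) Complex.ofReal_zero)

/-! ### The transform of the translated pairing: `ȟ_a(p) = Σ_μ χ̂_{a,μ}(p) Ψ_μ(p)` -/

/-- The kernel of `hatE` is the tree's plane wave `phase y p = e^{ip·y}`. [cite: Federbush1986PhaseCellI, (3.12) p. 328] -/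
theorem phase_toC_eq_cexp (y : E4) (p : Fin 4 → ℝ) :
    phase y (toC p) = cexp (I * ∑ k, (p k : ℂ) * ((y k : ℝ) : ℂ)) := rfl

/-- The conjugate plane wave `e^{−ip·z}`. [cite: Federbush1986PhaseCellI, (3.10), (3.12) p. 328] -/
def cphase (p : Fin 4 → ℝ) (z : E4) : ℂ := cexp (-I * ∑ k, (p k : ℂ) * ((z k : ℝ) : ℂ))

/-- `|e^{−ip·z}| = 1`. [cite: Federbush1986PhaseCellI, (3.12) p. 328] -/
theorem norm_cphase (p : Fin 4 → ℝ) (z : E4) : ‖cphase p z‖ = 1 := by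
  rw [cphase, show -I * ∑ k, (p k : ℂ) * ((z k : ℝ) : ℂ) = ((-(∑ k, p k * z k) : ℝ) : ℂ) * I by push_cast; ring,
    Complex.norm_exp_ofReal_mul_I]

/-- `z ↦ e^{−ip·z}` is continuous. [cite: Federbush1986PhaseCellI, (3.12) p. 328] -/
theorem continuous_cphase (p : Fin 4 → ℝ) : Continuous (cphase p) := by
  unfold cphase
  refine Complex.continuous_exp.comp (continuous_const.mul (continuous_finsetSum _ fun k _ => ?_))
  exact continuous_const.mul (continuous_ofReal.comp ((continuous_apply k).comp (PiLp.continuous_ofLp 2 _)))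

/-- `e^{ip·(a+b)} = e^{ip·a} e^{ip·b}`. [cite: Federbush1986PhaseCellI, (3.12) p. 328] -/
theorem phase_toC_add (a b : E4) (p : Fin 4 → ℝ) : phase (a + b) (toC p) = phase a (toC p) * phase b (toC p) := by
  simp only [phase_toC_eq_cexp, ← Complex.exp_add]
  congr 1
  simp only [PiLp.add_apply]
  push_cast
  rw [← mul_add, ← Finset.sum_add_distrib]
  congr 1
  exact Finset.sum_congr rfl fun k _ => by ring

/-- `e^{−ip·z} e^{ip·z} = 1`. [cite: Federbush1986PhaseCellI, (3.12) p. 328] -/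
theorem cphase_mul_phase (p : Fin 4 → ℝ) (z : E4) : cphase p z * phase z (toC p) = 1 := by
  rw [cphase, phase_toC_eq_cexp, ← Complex.exp_add]
  convert Complex.exp_zero using 2
  ring

/-- `e^{ip·(w − z)} = e^{−ip·z} e^{ip·w}`. [cite: Federbush1986PhaseCellI, (3.12) p. 328] -/
theorem phase_toC_sub (w z : E4) (p : Fin 4 → ℝ) : phase (w - z) (toC p) = cphase p z * phase w (toC p) := by
  have h := phase_toC_add (w - z) z p
  rw [sub_add_cancel] at h
  have h1 : phase z (toC p) ≠ 0 := by rw [phase_toC_eq_cexp]; exact Complex.exp_ne_zero _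
  calc phase (w - z) (toC p) = phase (w - z) (toC p) * (cphase p z * phase z (toC p)) := by rw [cphase_mul_phase, mul_one]
    _ = cphase p z * (phase (w - z) (toC p) * phase z (toC p)) := by ring
    _ = cphase p z * phase w (toC p) := by rw [← h]

/-- **The bare transform of a component of the origin plaquette's test function**: `χ̂_{a,μ}(p) = ∫ e^{−ip·z} χ_a(z)_μ d⁴z`
(for all `p_k ≠ 0` this is print's `P̃_a(p)_μ` without the convention factor, `chiHat_eq_fourierFactor`).
[cite: Federbush1986PhaseCellI, (3.8)–(3.10) p. 328] -/
def chiHat (a : Fin 6) (μ : Fin 4) (p : Fin 4 → ℝ) : ℂ := ∫ z : E4, cphase p z * ((plaqTestField (plaq0 a) z μ : ℝ) : ℂ)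

/-- `|χ̂_{a,μ}(p)| ≤ ‖χ_{a,μ}‖_{L¹}`, uniformly in `p`. [cite: Federbush1986PhaseCellI, (3.8)–(3.10) p. 328] -/
theorem norm_chiHat_le (a : Fin 6) (μ : Fin 4) (p : Fin 4 → ℝ) : ‖chiHat a μ p‖ ≤ ∫ z, |plaqTestField (plaq0 a) z μ| := by
  unfold chiHat
  refine (norm_integral_le_integral_norm _).trans (le_of_eq (integral_congr_ae (ae_of_all _ fun z => ?_)))
  dsimp only
  rw [norm_mul, norm_cphase, one_mul, Complex.norm_real, Real.norm_eq_abs]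

/-- **(3.10)**: off the coordinate hyperplanes `χ̂_{a,μ} = P̃_{a,μ}` (the tree's `fourierFactor`, r17 gen 10).
[cite: Federbush1986PhaseCellI, (3.8)–(3.10) p. 328] -/
theorem chiHat_eq_fourierFactor (a : Fin 6) (μ : Fin 4) {p : Fin 4 → ℝ} (hp : ∀ k, p k ≠ 0) :
    chiHat a μ p = fourierFactor (axisPair a).1 (axisPair a).2 p μ := by
  unfold chiHat plaq0 cphase
  rw [fourier_plaqTestField_level0 0 (axisPair_fst_ne_snd a) p hp μ]
  simp

/-- **The transform of the translated pairing factorises through the plaquette transform**: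
`ȟ_a(p) = ∫ e^{ip·y} h_a(y) d⁴y = Σ_μ χ̂_{a,μ}(p) Ψ_μ(p)` for EVERY real `p` (Fubini after the shear `(z, y) ↦ (z, z + y)`,
translation invariance of `d⁴y`). [cite: Federbush1986PhaseCellI, (3.6)–(3.7) p. 327, (3.10)–(3.12) p. 328] -/
theorem hatE_pairTC (hψ : ContDiff ℝ ∞ ψ) (hsupp : HasCompactSupport ψ) (a : Fin 6) (p : Fin 4 → ℝ) :
    hatE (pairTC ψ a) p = ∑ μ, chiHat a μ p * tfT ψ μ p := by
  have hcont : Continuous ψ := hψ.continuous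
  obtain ⟨B, hB0, hB⟩ := exists_bound hcont hsupp
  set χ : Fin 4 → E4 → ℂ := fun μ z => ((plaqTestField (plaq0 a) z μ : ℝ) : ℂ) with hχ_def
  have hχi : ∀ μ, Integrable (χ μ) := fun μ => (integrable_plaqTestField (plaq0 a) μ).ofReal
  have hψC : ∀ μ y, ‖cpt ψ μ y‖ ≤ B := fun μ y => by
    rw [cpt, Complex.norm_real, Real.norm_eq_abs]; exact hB y μ
  have hcptc : ∀ μ, Continuous (cpt ψ μ) := fun μ => (contDiff_cpt hψ μ).continuous
  -- the shear-integrable kernel `G_μ(z, y) = e^{ip·y} χ_μ(z) ψ_μ(z + y)`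
  set G : Fin 4 → E4 → E4 → ℂ := fun μ z y => phase y (toC p) * (χ μ z * cpt ψ μ (z + y)) with hG_def
  have hGint : ∀ μ, Integrable (Function.uncurry (G μ)) (volume.prod volume) := by
    intro μ
    -- `H_μ(z, w) = (e^{−ip·z} χ_μ(z)) · (e^{ip·w} ψ_μ(w))` is a product of integrable functions
    have h1 : Integrable (fun z : E4 => cphase p z * χ μ z) :=
      (hχi μ).bdd_mul (c := 1) (continuous_cphase p).aestronglyMeasurable
        (ae_of_all _ fun z => (norm_cphase p z).le)
    have h2 : Integrable (fun w : E4 => phase w (toC p) * cpt ψ μ w) :=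
      (integrable_cpt hψ hsupp μ).bdd_mul (c := 1)
        ((continuous_phase_toC.comp (Continuous.prodMk_left p)).aestronglyMeasurable)
        (ae_of_all _ fun w => (norm_phase_toC w p).le)
    have hH : Integrable (fun zw : E4 × E4 => (cphase p zw.1 * χ μ zw.1) * (phase zw.2 (toC p) * cpt ψ μ zw.2))
        (volume.prod volume) := h1.mul_prod h2
    have hS := (measurePreserving_prod_add (volume : Measure E4) (volume : Measure E4)).integrable_comp hH.aestronglyMeasurable
    have hcomp : (fun zw : E4 × E4 => (cphase p zw.1 * χ μ zw.1) * (phase zw.2 (toC p) * cpt ψ μ zw.2))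
        ∘ (fun zy : E4 × E4 => (zy.1, zy.1 + zy.2)) = Function.uncurry (G μ) := by
      funext zy
      simp only [Function.comp_apply, hG_def, phase_toC_add]
      have := cphase_mul_phase p zy.1
      calc cphase p zy.1 * χ μ zy.1 * (phase zy.1 (toC p) * phase zy.2 (toC p) * cpt ψ μ (zy.1 + zy.2))
          = (cphase p zy.1 * phase zy.1 (toC p)) * (phase zy.2 (toC p) * (χ μ zy.1 * cpt ψ μ (zy.1 + zy.2))) := by ring
        _ = phase zy.2 (toC p) * (χ μ zy.1 * cpt ψ μ (zy.1 + zy.2)) := by rw [this, one_mul]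
    rw [hcomp] at hS
    exact hS.mpr hH
  -- integrability of the `z`-sections (every `y`) and of `y ↦ ∫ dz G_μ`
  have hGz : ∀ μ y, Integrable (fun z => G μ z y) := by
    intro μ y
    have h := (hχi μ).bdd_mul (c := B) (f := fun z => phase y (toC p) * cpt ψ μ (z + y))
      ((continuous_const.mul ((hcptc μ).comp (continuous_add_const y))).aestronglyMeasurable)
      (ae_of_all _ fun z => by rw [norm_mul, norm_phase_toC, one_mul]; exact hψC μ (z + y))
    refine h.congr (ae_of_all _ fun z => ?_)
    simp only [hG_def]; ring
  have hGy : ∀ μ, Integrable (fun y => ∫ z, G μ z y) := fun μ => (hGint μ).integral_prod_right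
  -- Step 1: `e^{ip·y} h_a(y) = Σ_μ ∫ dz G_μ(z, y)` for every `y`
  have h1 : ∀ y : E4, cexp (I * ∑ k, (p k : ℂ) * ((y k : ℝ) : ℂ)) * pairTC ψ a y = ∑ μ, ∫ z, G μ z y := by
    intro y
    rw [pairTC, pairT, ← integral_complex_ofReal, ← integral_const_mul, ← integral_finsetSum _ fun μ _ => hGz μ y]
    refine integral_congr_ae (ae_of_all _ fun z => ?_)
    dsimp only
    rw [Complex.ofReal_sum, Finset.mul_sum]
    refine Finset.sum_congr rfl fun μ _ => ?_
    simp only [hG_def, hχ_def, cpt, Complex.ofReal_mul, phase_toC_eq_cexp]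
  -- Step 2: the inner `y`-integral after Fubini: `∫ dy e^{ip·y} ψ_μ(z + y) = e^{−ip·z} Ψ_μ(p)`
  have h2 : ∀ μ (z : E4), ∫ y, G μ z y = χ μ z * (cphase p z * tfT ψ μ p) := by
    intro μ z
    have hg : (fun y => G μ z y) = fun y => χ μ z * ((fun w => phase (w - z) (toC p) * cpt ψ μ w) (y + z)) := by
      funext y
      simp only [hG_def, add_sub_cancel_right, add_comm z y]
      ring
    rw [hg, integral_const_mul, integral_add_right_eq_self (fun w => phase (w - z) (toC p) * cpt ψ μ w) z]
    congr 1
    simp_rw [phase_toC_sub _ z p, mul_assoc]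
    rw [integral_const_mul]
    rfl
  unfold hatE
  simp_rw [h1]
  rw [integral_finsetSum _ fun μ _ => hGy μ]
  refine Finset.sum_congr rfl fun μ _ => ?_
  rw [← integral_integral_swap (hGint μ)]
  simp_rw [h2]
  rw [chiHat, ← integral_mul_const]
  refine integral_congr_ae (ae_of_all _ fun z => ?_)
  simp only [hχ_def]
  ring

/-- **The transform of the translated pairing has inverse-square product decay** (`Σ_μ ‖χ_{a,μ}‖_{L¹} · C_μ`).
[cite: FederbushWilliamson1987PhaseCellII, (6.8) p. 1418; Federbush1986PhaseCellI, (3.6)–(3.7) p. 327] -/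
theorem invSqDecay_hatE_pairTC (hψ : ContDiff ℝ ∞ ψ) (hsupp : HasCompactSupport ψ) (a : Fin 6) :
    ∃ C, HasInvSqDecay (hatE (pairTC ψ a)) C := by
  choose C hC0 hC using fun μ => tfT_isotropic_decay hψ hsupp μ
  have hχ0 : ∀ μ, 0 ≤ ∫ z, |plaqTestField (plaq0 a) z μ| := fun μ => integral_nonneg fun z => abs_nonneg _
  refine ⟨∑ μ, (∫ z, |plaqTestField (plaq0 a) z μ|) * C μ,
    HasInvSqDecay.of_isotropic (Finset.sum_nonneg fun μ _ => mul_nonneg (hχ0 μ) (hC0 μ)) fun p => ?_⟩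
  rw [hatE_pairTC hψ hsupp a p, Finset.sum_mul]
  refine (norm_sum_le _ _).trans (Finset.sum_le_sum fun μ _ => ?_)
  rw [norm_mul, mul_assoc]
  exact mul_le_mul (norm_chiHat_le a μ p) (hC μ p) (norm_nonneg _) (hχ0 μ)

/-- **Poisson summation for the translated pairing of a CONSTRAINT-PRESERVING test field**: if every level-0 plaquette
variable `(χ_q, ψ)` vanishes, then `Σ_{n∈ℤ⁴} ȟ_a(p + 2πn) = 0` for every real `p` and every axis pair `a`.
[cite: Federbush1986PhaseCellI, (3.3)–(3.4), (3.6)–(3.7) p. 327; SteinWeiss1971, Ch. VII §2 Thm 2.4] -/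
theorem perSum_hatE_pairTC_eq_zero (hψ : ContDiff ℝ ∞ ψ) (hsupp : HasCompactSupport ψ)
    (hplaq : ∀ q : Plaq 0, plaqFunctional 0 ψ q = 0) (a : Fin 6) (p : Fin 4 → ℝ) :
    perSum (hatE (pairTC ψ a)) p = 0 := by
  obtain ⟨C, hC⟩ := invSqDecay_hatE_pairTC hψ hsupp a
  refine perSum_hatE_eq_zero_of_invSqDecay (continuous_pairTC hψ.continuous hsupp a)
    (integrable_pairTC hψ.continuous hsupp a) hC (fun m => ?_) p
  show ((pairT ψ a (latPt m) : ℝ) : ℂ) = 0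
  rw [pairT_latPt hψ.continuous, hplaq, Complex.ofReal_zero]

/-- The PLAQUETTE side of the first variation in momentum space: `G_a(q) = Σ_μ P̃_{a,μ}(q) Ψ_μ(q)` (the tree's `fourierFactor`).
[cite: Federbush1986PhaseCellI, (3.6)–(3.10) p. 327–328] -/
def plaqSide (ψ : E4 → Fin 4 → ℝ) (a : Fin 6) (q : Fin 4 → ℝ) : ℂ :=
  ∑ μ, fourierFactor (axisPair a).1 (axisPair a).2 q μ * tfT ψ μ q

/-- Off the coordinate hyperplanes the plaquette side IS the transform of the translated pairing.
[cite: Federbush1986PhaseCellI, (3.6)–(3.10) p. 327–328] -/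
theorem plaqSide_eq_hatE (hψ : ContDiff ℝ ∞ ψ) (hsupp : HasCompactSupport ψ) (a : Fin 6) {q : Fin 4 → ℝ}
    (hq : ∀ k, q k ≠ 0) : plaqSide ψ a q = hatE (pairTC ψ a) q := by
  rw [hatE_pairTC hψ hsupp a q, plaqSide]
  exact Finset.sum_congr rfl fun μ _ => by rw [chiHat_eq_fourierFactor a μ hq]

/-- **Off the lattice hyperplanes the periodisation of the plaquette side vanishes** for a constraint-preserving test field.
[cite: Federbush1986PhaseCellI, (3.3)–(3.4), (3.6)–(3.7) p. 327] -/
theorem perSum_plaqSide_eq_zero (hψ : ContDiff ℝ ∞ ψ) (hsupp : HasCompactSupport ψ)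
    (hplaq : ∀ q : Plaq 0, plaqFunctional 0 ψ q = 0) (a : Fin 6) {p : Fin 4 → ℝ}
    (hp : ∀ k (m : ℤ), p k ≠ 2 * Real.pi * m) : perSum (plaqSide ψ a) p = 0 := by
  rw [← perSum_hatE_pairTC_eq_zero hψ hsupp hplaq a p]
  unfold perSum
  exact tsum_congr fun n => plaqSide_eq_hatE hψ hsupp a fun k => shiftR_ne_zero (hp k) n

/-- The shifted plaquette side is summable over the lattice (off the lattice hyperplanes).
[cite: FederbushWilliamson1987PhaseCellII, (1.4) p. 1416, (6.8) p. 1418] -/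
theorem summable_plaqSide_shiftR (hψ : ContDiff ℝ ∞ ψ) (hsupp : HasCompactSupport ψ) (a : Fin 6) {p : Fin 4 → ℝ}
    (hp : ∀ k (m : ℤ), p k ≠ 2 * Real.pi * m) : Summable fun n : Fin 4 → ℤ => plaqSide ψ a (shiftR p n) := by
  obtain ⟨C, hC⟩ := invSqDecay_hatE_pairTC hψ hsupp a
  refine (hC.summable_shiftR p).congr fun n => ?_
  exact (plaqSide_eq_hatE hψ hsupp a fun k => shiftR_ne_zero (hp k) n).symm

/-! ## §3 The multiplier identity: `Σ_ν Λ_ν b̂_ν Ψ_ν = −Σ_a x_a G_a` pointwise off the lattice hyperplanes -/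

/-- `x_a` is `2π`-periodic. [cite: FederbushWilliamson1987PhaseCellII, (3.1) p. 1417] -/
@[simp] theorem xLam_shift (p : Momentum) (n : Fin 4 → ℤ) : xLam (shift p n) = xLam p := by
  simp [xLam]

/-- **The bond-side multiplier sum is (minus) the plaquette-multiplier sum**: at a real momentum off the lattice hyperplanes,
`Σ_ν Λ_ν(q) b̂_ν(q) Ψ_ν(q) = −Σ_a x_a(q) Σ_μ P̃_{a,μ}(q) Ψ_μ(q)` — `Λ` is a lattice co-boundary (`Lam_eq_sum_xLam`) and `P̃_a` is
the lattice curl of `b̂` (`fourierFactor_eq_bondFactor`). [cite: Federbush1986PhaseCellI, (3.4) p. 327, (3.10)–(3.11) p. 328;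
FederbushWilliamson1987PhaseCellII, (1.8)–(1.9) p. 1416, (2.1)–(2.3) p. 1417] -/
theorem sum_Lam_bondFactor_eq (ψ : E4 → Fin 4 → ℝ) {q : Fin 4 → ℝ} (hq : ∀ k (m : ℤ), q k ≠ 2 * Real.pi * m) :
    ∑ ν, Lam ν (toC q) * bondFactor ν q * tfT ψ ν q = -∑ a, xLam (toC q) a * plaqSide ψ a q := by
  have hf : ∀ μ, f (toC q) μ ≠ 0 := fun μ => f_toC_ne_zero (hq μ)
  have hL : ∀ ν, Lam ν (toC q) = ∑ a, w ν a * partnerF a ν (toC q) * xLam (toC q) a := fun ν => Lam_eq_sum_xLam hf ν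
  have hP : ∀ a, plaqSide ψ a q = -(f (toC q) (axisPair a).2 * bondFactor (axisPair a).1 q * tfT ψ (axisPair a).1 q)
      + f (toC q) (axisPair a).1 * bondFactor (axisPair a).2 q * tfT ψ (axisPair a).2 q := by
    intro a
    unfold plaqSide
    simp_rw [fourierFactor_eq_bondFactor a q]
    have hne := axisPair_fst_ne_snd a
    simp only [add_mul, ite_mul, zero_mul, Finset.sum_add_distrib, Finset.sum_ite_eq', Finset.mem_univ, if_true]
    ring
  simp_rw [hL, hP]
  simp only [Fin.sum_univ_succ, Fin.sum_univ_zero, w, partnerF, axisPair]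
  simp
  ring

/-! ## §4 A general Fubini lemma: a real weight against a momentum-space field -/

/-- **Fubini for `∫ d⁴x g(x)·(∫ d⁴p e^{ip·x} F(p))`** with `g ∈ L¹(ℝ⁴)` real and `p ↦ F(p)` integrable: the `x`-integral of
`g · modeFT F` is `∫ d⁴p ĝ(p) F(p)` with `ĝ = hatE g` (kernel `e^{+ip·x}`). [cite: Federbush1986PhaseCellI, (3.12) p. 328, (3.6)–(3.7) p. 327] -/
theorem integral_ofReal_mul_modeFT {g : E4 → ℝ} (hg : Integrable g) {F : Momentum → ℂ}
    (hF : Integrable fun p : Fin 4 → ℝ => F (toC p)) :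
    Integrable (fun x => (g x : ℂ) * modeFT F x) ∧
    ∫ x, (g x : ℂ) * modeFT F x = ∫ p : Fin 4 → ℝ, hatE (fun x => (g x : ℂ)) p * F (toC p) := by
  set f : E4 → (Fin 4 → ℝ) → ℂ := fun z p => (g z : ℂ) * (phase z (toC p) * F (toC p)) with hf
  have hprod : Integrable (fun zp : E4 × (Fin 4 → ℝ) => (g zp.1 : ℂ) * F (toC zp.2)) (volume.prod volume) :=
    hg.ofReal.mul_prod hF
  have hFub : Integrable (Function.uncurry f) (volume.prod volume) := by
    have h := hprod.bdd_mul (c := 1) continuous_phase_toC.aestronglyMeasurable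
      (ae_of_all _ fun zp => (norm_phase_toC zp.1 zp.2).le)
    refine h.congr (ae_of_all _ fun zp => ?_)
    show phase zp.1 (toC zp.2) * _ = (g zp.1 : ℂ) * _
    ring
  have h1 : ∀ z, ∫ p, f z p = (g z : ℂ) * modeFT F z := fun z => integral_const_mul _ _
  have h2 : ∀ p : Fin 4 → ℝ, ∫ z, f z p = hatE (fun x => (g x : ℂ)) p * F (toC p) := by
    intro p
    rw [hatE, ← integral_mul_const]
    exact integral_congr_ae (ae_of_all _ fun z => by simp only [hf, phase_toC_eq_cexp]; ring)
  refine ⟨hFub.integral_prod_left.congr (ae_of_all _ h1), ?_⟩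
  rw [← integral_congr_ae (ae_of_all _ h1), integral_integral_swap hFub]
  exact integral_congr_ae (ae_of_all _ h2)

end PlaquetteGram

/-! ## §5 The corrected mode's field strength in momentum space -/

namespace CorrectedMode

open PlaquetteGram ModeLinearity

variable {ψ : E4 → Fin 4 → ℝ}
open ModeDecay (toC phase modeFT modeField dKernel)
open ModeAnalyticityCorrectedGauge (Xc)
open ModeAnalyticityCellPositivity (gcorr delta0 delta0_pos)
open ModeAnalyticityThms31to33Corrected (analyticOnNhd_gcorr)
open ModeAnalyticityThm33Corrected (norm_gcorr_le)

/-- Print's Fourier-convention constant `(1/2π)²`. [cite: Federbush1986PhaseCellI, (3.10) p. 328] -/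
def kR : ℝ := ((2 * Real.pi) ^ 2)⁻¹

/-- The momentum-space mode of the field `A^N = field s`: `ĝ_μ = (1/2π)² gcorr s μ`. [cite: Federbush1986PhaseCellI, (3.12) p. 328; FederbushWilliamson1987PhaseCellII, (2.4) p. 1417] -/
def ghat (s : ℕ) (μ : Fin 4) (z : Momentum) : ℂ := ((kR : ℝ) : ℂ) * gcorr s μ z

/-- `field s` is the position-space field of `ĝ`. [cite: Federbush1986PhaseCellI, (3.12)–(3.13) p. 328] -/
theorem field_eq (s : ℕ) : field s = modeField (ghat s) := rfl

/-- **Part II's hypotheses for `ĝ`**: analytic on `𝒟_G(δ₀)`, bounded by `c Π_j(|p_j|+1)⁻¹(|p²|+1)⁻¹` on `𝒟_B(δ₀)` with ONE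
constant for the four components (Theorems 3.2–3.3 for the corrected mode, p04). [cite: FederbushWilliamson1987PhaseCellII, Theorems 3.2–3.3 p. 1417] -/
theorem ghat_pack (s : ℕ) : ∃ c : ℝ, (∀ μ, AnalyticOnNhd ℂ (ghat s μ) (DG delta0)) ∧
    ∀ μ, ∀ z ∈ DB delta0, ‖ghat s μ z‖ ≤ c * (∏ j, (‖z j‖ + 1)⁻¹) * (‖csq z‖ + 1)⁻¹ := by
  choose c hc0 hc using fun μ => norm_gcorr_le s μ
  refine ⟨kR * ∑ μ, c μ, fun μ => analyticOnNhd_const.mul (analyticOnNhd_gcorr s μ), fun μ z hz => ?_⟩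
  have hk : 0 ≤ kR := by unfold kR; positivity
  have hM : 0 ≤ (∏ j, (‖z j‖ + 1)⁻¹) * (‖csq z‖ + 1)⁻¹ := by positivity
  have hcμ : c μ ≤ ∑ ν, c ν := Finset.single_le_sum (f := c) (fun ν _ => hc0 ν) (Finset.mem_univ μ)
  rw [ghat, norm_mul, Complex.norm_real, Real.norm_of_nonneg hk]
  calc kR * ‖gcorr s μ z‖ ≤ kR * (c μ * (∏ j, (‖z j‖ + 1)⁻¹) * (‖csq z‖ + 1)⁻¹) :=
        mul_le_mul_of_nonneg_left (hc μ z hz) hk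
    _ = kR * c μ * ((∏ j, (‖z j‖ + 1)⁻¹) * (‖csq z‖ + 1)⁻¹) := by ring
    _ ≤ kR * (∑ ν, c ν) * ((∏ j, (‖z j‖ + 1)⁻¹) * (‖csq z‖ + 1)⁻¹) :=
        mul_le_mul_of_nonneg_right (mul_le_mul_of_nonneg_left hcμ hk) hM
    _ = _ := by ring

/-- `ĝ = (1/2π)²(A′ + pX_c)` at every real momentum off the lattice hyperplanes. [cite: FederbushWilliamson1987PhaseCellII, (2.4) p. 1417] -/
theorem ghat_toC_eq (s : ℕ) (μ : Fin 4) {p : Fin 4 → ℝ} (hp : ∀ k (m : ℤ), p k ≠ 2 * Real.pi * m) :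
    ghat s μ (toC p) = ((kR : ℝ) : ℂ) * (Aprime μ (toC p) + toC p μ * Xc s (toC p)) := by
  rw [ghat, gcorr_toC_eq s μ hp]

/-- `p ↦ ĝ_μ(p)` is continuous on the real momenta. [cite: FederbushWilliamson1987PhaseCellII, Theorem 3.2 p. 1417] -/
theorem continuous_ghat_toC (s : ℕ) (μ : Fin 4) : Continuous fun p : Fin 4 → ℝ => ghat s μ (toC p) := by
  obtain ⟨c, hA, -⟩ := ghat_pack s
  have htoC : Continuous (toC : (Fin 4 → ℝ) → Momentum) := continuous_pi fun j => continuous_ofReal.comp (continuous_apply j)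
  exact (hA μ).continuousOn.comp_continuous htoC fun p j => by simp [toC, delta0_pos]

/-- `p ↦ p_ν ĝ_μ(p)` is integrable on `ℝ⁴` (dominated by `c Σ_j ψ_j`, `ModeDecay.sum_abs_mul_norm_le`).
[cite: FederbushWilliamson1987PhaseCellII, Theorem 3.3 (3.5) p. 1417, §IV p. 1417] -/
theorem integrable_coord_mul_ghat (s : ℕ) (μ ν : Fin 4) :
    Integrable fun p : Fin 4 → ℝ => (p ν : ℂ) * ghat s μ (toC p) := by
  obtain ⟨c, hA, hB⟩ := ghat_pack s
  have hcont : Continuous fun p : Fin 4 → ℝ => (p ν : ℂ) * ghat s μ (toC p) :=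
    (continuous_ofReal.comp (continuous_apply ν)).mul (continuous_ghat_toC s μ)
  refine Integrable.mono' ((integrable_finsetSum Finset.univ fun j _ => ModeDecay.integrable_psi j).const_mul c)
    hcont.aestronglyMeasurable (ae_of_all _ fun p => ?_)
  have h := ModeDecay.sum_abs_mul_norm_le delta0_pos (hB μ) p
  rw [norm_mul, Complex.norm_real, Real.norm_eq_abs]
  refine le_trans (mul_le_mul_of_nonneg_right ?_ (norm_nonneg _)) h
  exact Finset.single_le_sum (f := fun j => |p j|) (fun j _ => abs_nonneg _) (Finset.mem_univ ν)

/-- The momentum-space field strength of the mode (times `i`): `F̂_{μν}(z) = i(z_μ ĝ_ν(z) − z_ν ĝ_μ(z))`.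
[cite: Federbush1986PhaseCellI, (3.4) p. 327, (3.12)–(3.14) p. 328] -/
def FNhatC (s : ℕ) (μ ν : Fin 4) (z : Momentum) : ℂ := I * (z μ * ghat s ν z - z ν * ghat s μ z)

/-- `p ↦ F̂_{μν}(p)` is integrable on the real momenta. [cite: Federbush1986PhaseCellI, (3.14) p. 328] -/
theorem integrable_FNhatC (s : ℕ) (μ ν : Fin 4) : Integrable fun p : Fin 4 → ℝ => FNhatC s μ ν (toC p) := by
  have h := ((integrable_coord_mul_ghat s ν μ).sub (integrable_coord_mul_ghat s μ ν)).const_mul I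
  refine h.congr (ae_of_all _ fun p => ?_)
  simp only [FNhatC, toC_apply, Pi.sub_apply]

/-- **The field strength of `A^N` as a momentum integral**: `F_{μν}(A^N)(x) = Re ∫ d⁴p e^{ip·x} i(p_μĝ_ν − p_νĝ_μ)(p)`
(differentiation under the integral, `ModeDecay.fderiv_modeFT_unitVec`). [cite: Federbush1986PhaseCellI, (3.14) p. 328, §0 p. 319–320] -/
theorem fieldStrength_field_eq (s : ℕ) (μ ν : Fin 4) (x : E4) :
    fieldStrength (field s) μ ν x = (modeFT (FNhatC s μ ν) x).re := by
  obtain ⟨c, hA, hB⟩ := ghat_pack s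
  have hpd : ∀ α β : Fin 4, pd (field s) α β x = (∫ p : Fin 4 → ℝ, dKernel (ghat s β) α x (toC p)).re := by
    intro α β
    rw [field_eq, ModeDecay.pd_modeField delta0_pos hA hB x α β, ModeDecay.fderiv_modeFT_unitVec delta0_pos (hA β) (hB β) x α]
  have hint : ∀ α β : Fin 4, Integrable fun p : Fin 4 → ℝ => dKernel (ghat s β) α x (toC p) := by
    intro α β
    have hmeas : Continuous fun p : Fin 4 → ℝ => phase x (toC p) * I :=
      (continuous_phase_toC.comp (Continuous.prodMk_right x)).mul continuous_const
    have h := (integrable_coord_mul_ghat s β α).bdd_mul (c := 1) (f := fun p : Fin 4 → ℝ => phase x (toC p) * I)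
      hmeas.aestronglyMeasurable (ae_of_all _ fun p => by simp [norm_phase_toC])
    refine h.congr (ae_of_all _ fun p => ?_)
    simp only [dKernel, toC_apply]
    ring
  unfold fieldStrength
  rw [hpd, hpd, ← Complex.sub_re, ← integral_sub (hint μ ν) (hint ν μ)]
  congr 1
  unfold ModeDecay.modeFT
  refine integral_congr_ae (ae_of_all _ fun p => ?_)
  simp only [dKernel, FNhatC, toC_apply]
  ring

/-- The position-space pairing with the momentum integral: `∫ d⁴x g(x) F_{μν}(A^N)(x) = Re ∫ d⁴p ĝ(p) F̂_{μν}(p)` for a real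
`L¹` weight `g`. [cite: Federbush1986PhaseCellI, (3.4) p. 327, (3.12)–(3.14) p. 328] -/
theorem integral_mul_fieldStrength_field {g : E4 → ℝ} (hg : Integrable g) (s : ℕ) (μ ν : Fin 4) :
    Integrable (fun x => g x * fieldStrength (field s) μ ν x) ∧
    ∫ x, g x * fieldStrength (field s) μ ν x = (∫ p : Fin 4 → ℝ, hatE (fun x => (g x : ℂ)) p * FNhatC s μ ν (toC p)).re := by
  obtain ⟨hI, hE⟩ := integral_ofReal_mul_modeFT hg (integrable_FNhatC s μ ν)
  have hre : ∀ x, g x * fieldStrength (field s) μ ν x = ((g x : ℂ) * modeFT (FNhatC s μ ν) x).re := fun x => by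
    rw [fieldStrength_field_eq, Complex.re_ofReal_mul]
  refine ⟨?_, ?_⟩
  · exact (hI.re).congr (ae_of_all _ fun x => (hre x).symm)
  · simp_rw [hre]
    rw [← hE]
    exact integral_re hI

/-! ## §6 The cross term `∫ Σ_{μ<ν} F_{μν}(A^N) F_{μν}(ψ)` in momentum space, and its vanishing -/

/-- `|ȟ(p)| ≤ ‖h‖_{L¹}`. [cite: Federbush1986PhaseCellI, (3.12) p. 328] -/
theorem norm_hatE_le (h : E4 → ℂ) (p : Fin 4 → ℝ) : ‖hatE h p‖ ≤ ∫ y, ‖h y‖ := by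
  unfold hatE
  refine (norm_integral_le_integral_norm _).trans (le_of_eq (integral_congr_ae (ae_of_all _ fun y => ?_)))
  dsimp only
  rw [← phase_toC_eq_cexp, norm_mul, norm_phase_toC, one_mul]

/-- The `hatE`-integrand of an integrable function is integrable. [cite: Federbush1986PhaseCellI, (3.12) p. 328] -/
theorem integrable_cexp_mul {h : E4 → ℂ} (hh : Integrable h) (p : Fin 4 → ℝ) :
    Integrable fun y : E4 => cexp (I * ∑ k, (p k : ℂ) * ((y k : ℝ) : ℂ)) * h y := by
  have h1 := hh.bdd_mul (c := 1) (f := fun y : E4 => phase y (toC p))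
    ((continuous_phase_toC.comp (Continuous.prodMk_left p)).aestronglyMeasurable)
    (ae_of_all _ fun y => (norm_phase_toC y p).le)
  exact h1.congr (ae_of_all _ fun y => by simp only [phase_toC_eq_cexp])

/-- The field strength of a test field is continuous with compact support, hence integrable. [cite: Federbush1986PhaseCellI, (3.4) p. 327] -/
theorem integrable_fieldStrength_test (hψ : ContDiff ℝ ∞ ψ) (hsupp : HasCompactSupport ψ) (μ ν : Fin 4) :
    Integrable (fieldStrength ψ μ ν) := by
  have hc : Continuous (fieldStrength ψ μ ν) := (continuous_pd hψ μ ν).sub (continuous_pd hψ ν μ)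
  exact hc.integrable_of_hasCompactSupport ((hasCompactSupport_pd hsupp μ ν).sub (hasCompactSupport_pd hsupp ν μ))

/-- **The transform of the field strength of a test field**: `∫ e^{ip·x} F_{μν}(ψ)(x) d⁴x = −i(p_μΨ_ν(p) − p_νΨ_μ(p))`.
[cite: Federbush1986PhaseCellI, (3.4)–(3.7) p. 327] -/
theorem hatE_fieldStrength (hψ : ContDiff ℝ ∞ ψ) (hsupp : HasCompactSupport ψ) (μ ν : Fin 4) (p : Fin 4 → ℝ) :
    hatE (fun x => ((fieldStrength ψ μ ν x : ℝ) : ℂ)) p = -I * ((p μ : ℂ) * tfT ψ ν p - (p ν : ℂ) * tfT ψ μ p) := by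
  have hi : ∀ α β : Fin 4, Integrable fun y : E4 => cexp (I * ∑ k, (p k : ℂ) * ((y k : ℝ) : ℂ)) * ((pd ψ α β y : ℝ) : ℂ) :=
    fun α β => integrable_cexp_mul (((continuous_pd hψ α β).integrable_of_hasCompactSupport
      (hasCompactSupport_pd hsupp α β)).ofReal) p
  have h1 : hatE (fun x => ((fieldStrength ψ μ ν x : ℝ) : ℂ)) p
      = hatE (fun x => ((pd ψ μ ν x : ℝ) : ℂ)) p - hatE (fun x => ((pd ψ ν μ x : ℝ) : ℂ)) p := by
    unfold hatE
    rw [← integral_sub (hi μ ν) (hi ν μ)]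
    refine integral_congr_ae (ae_of_all _ fun y => ?_)
    simp only [fieldStrength, Complex.ofReal_sub]
    ring
  rw [h1, hatE_pd hψ hsupp μ ν p, hatE_pd hψ hsupp ν μ p]
  ring

/-- The momentum-space integrand of the cross term: `Σ_{μ<ν} F̌_{μν}(ψ)(p) F̂_{μν}(p)`. [cite: Federbush1986PhaseCellI, (3.4) p. 327] -/
def crossIntegrand (s : ℕ) (ψ : E4 → Fin 4 → ℝ) (p : Fin 4 → ℝ) : ℂ :=
  ∑ μ, ∑ ν, if μ < ν then hatE (fun x => ((fieldStrength ψ μ ν x : ℝ) : ℂ)) p * FNhatC s μ ν (toC p) else 0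

/-- Each term of the momentum-space cross integrand is integrable (`F̌(ψ)` bounded, `F̂` integrable). [cite: Federbush1986PhaseCellI, (3.4) p. 327, (3.14) p. 328] -/
theorem integrable_cross_term (s : ℕ) (hψ : ContDiff ℝ ∞ ψ) (hsupp : HasCompactSupport ψ) (μ ν : Fin 4) :
    Integrable fun p : Fin 4 → ℝ => hatE (fun x => ((fieldStrength ψ μ ν x : ℝ) : ℂ)) p * FNhatC s μ ν (toC p) := by
  have hFi : Integrable fun x => ((fieldStrength ψ μ ν x : ℝ) : ℂ) := (integrable_fieldStrength_test hψ hsupp μ ν).ofReal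
  exact (integrable_FNhatC s μ ν).bdd_mul (c := ∫ y, ‖((fieldStrength ψ μ ν y : ℝ) : ℂ)‖)
    (continuous_hatE hFi).aestronglyMeasurable (ae_of_all _ fun p => norm_hatE_le _ p)

/-- The momentum-space cross integrand is integrable. [cite: Federbush1986PhaseCellI, (3.4) p. 327] -/
theorem integrable_crossIntegrand (s : ℕ) (hψ : ContDiff ℝ ∞ ψ) (hsupp : HasCompactSupport ψ) :
    Integrable (crossIntegrand s ψ) := by
  refine integrable_finsetSum _ fun μ _ => integrable_finsetSum _ fun ν _ => ?_
  by_cases h : μ < ν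
  · simp only [h, if_true]; exact integrable_cross_term s hψ hsupp μ ν
  · simp only [h, if_false]; exact integrable_zero _ _ _

/-- **The cross term in momentum space**: `∫ d⁴x Σ_{μ<ν} F_{μν}(A^N)(x) F_{μν}(ψ)(x) = Re ∫ d⁴p Σ_{μ<ν} F̌_{μν}(ψ)(p) F̂_{μν}(p)`
(Fubini term by term). [cite: Federbush1986PhaseCellI, (3.4) p. 327 (the first variation of `½∫Σ(∂A′_i/∂x_j)²`), (3.12)–(3.14) p. 328] -/
theorem integral_crossDensity_eq (s : ℕ) (hψ : ContDiff ℝ ∞ ψ) (hsupp : HasCompactSupport ψ) :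
    ∫ x, crossDensity (field s) ψ x = (∫ p : Fin 4 → ℝ, crossIntegrand s ψ p).re := by
  have hterm := fun μ ν => integral_mul_fieldStrength_field (integrable_fieldStrength_test hψ hsupp μ ν) s μ ν
  have hix : ∀ μ ν : Fin 4, Integrable fun x =>
      if μ < ν then fieldStrength (field s) μ ν x * fieldStrength ψ μ ν x else 0 := by
    intro μ ν
    by_cases h : μ < ν
    · simp only [h, if_true]
      exact ((hterm μ ν).1).congr (ae_of_all _ fun x => mul_comm _ _)
    · simp only [h, if_false]; exact integrable_zero _ _ _
  have hip : ∀ μ ν : Fin 4, Integrable fun p : Fin 4 → ℝ =>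
      if μ < ν then hatE (fun x => ((fieldStrength ψ μ ν x : ℝ) : ℂ)) p * FNhatC s μ ν (toC p) else 0 := by
    intro μ ν
    by_cases h : μ < ν
    · simp only [h, if_true]; exact integrable_cross_term s hψ hsupp μ ν
    · simp only [h, if_false]; exact integrable_zero _ _ _
  have hL : ∫ x, crossDensity (field s) ψ x
      = ∑ μ, ∑ ν, if μ < ν then ∫ x, fieldStrength (field s) μ ν x * fieldStrength ψ μ ν x else 0 := by
    unfold crossDensity
    rw [integral_finsetSum _ fun μ _ => integrable_finsetSum _ fun ν _ => hix μ ν]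
    refine Finset.sum_congr rfl fun μ _ => ?_
    rw [integral_finsetSum _ fun ν _ => hix μ ν]
    refine Finset.sum_congr rfl fun ν _ => ?_
    split_ifs <;> simp
  have hR : (∫ p : Fin 4 → ℝ, crossIntegrand s ψ p).re
      = ∑ μ, ∑ ν, if μ < ν then (∫ p : Fin 4 → ℝ,
          hatE (fun x => ((fieldStrength ψ μ ν x : ℝ) : ℂ)) p * FNhatC s μ ν (toC p)).re else 0 := by
    unfold crossIntegrand
    rw [integral_finsetSum _ fun μ _ => integrable_finsetSum _ fun ν _ => hip μ ν, Complex.re_sum]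
    refine Finset.sum_congr rfl fun μ _ => ?_
    rw [integral_finsetSum _ fun ν _ => hip μ ν, Complex.re_sum]
    refine Finset.sum_congr rfl fun ν _ => ?_
    split_ifs <;> simp
  rw [hL, hR]
  refine Finset.sum_congr rfl fun μ _ => Finset.sum_congr rfl fun ν _ => ?_
  split_ifs with h
  · rw [← (hterm μ ν).2]
    exact integral_congr_ae (ae_of_all _ fun x => mul_comm _ _)
  · rfl

/-- The Lagrange identity on four coordinates: `Σ_{μ<ν}(p_μa_ν − p_νa_μ)(p_μb_ν − p_νb_μ) = p²(a·b) − (p·a)(p·b)`. [folklore] -/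
private theorem lagrange_fin4 {R : Type*} [CommRing R] (p a b : Fin 4 → R) :
    ∑ μ, ∑ ν, (if μ < ν then (p μ * a ν - p ν * a μ) * (p μ * b ν - p ν * b μ) else 0)
      = (∑ k, p k ^ 2) * (∑ k, a k * b k) - (∑ k, p k * a k) * (∑ k, p k * b k) := by
  simp only [Fin.sum_univ_four, Fin.isValue]
  have h01 : (0 : Fin 4) < 1 := by decide
  have h02 : (0 : Fin 4) < 2 := by decide
  have h03 : (0 : Fin 4) < 3 := by decide
  have h12 : (1 : Fin 4) < 2 := by decide
  have h13 : (1 : Fin 4) < 3 := by decide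
  have h23 : (2 : Fin 4) < 3 := by decide
  have n00 : ¬ (0 : Fin 4) < 0 := by decide
  have n10 : ¬ (1 : Fin 4) < 0 := by decide
  have n11 : ¬ (1 : Fin 4) < 1 := by decide
  have n20 : ¬ (2 : Fin 4) < 0 := by decide
  have n21 : ¬ (2 : Fin 4) < 1 := by decide
  have n22 : ¬ (2 : Fin 4) < 2 := by decide
  have n30 : ¬ (3 : Fin 4) < 0 := by decide
  have n31 : ¬ (3 : Fin 4) < 1 := by decide
  have n32 : ¬ (3 : Fin 4) < 2 := by decide
  have n33 : ¬ (3 : Fin 4) < 3 := by decide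
  simp only [h01, h02, h03, h12, h13, h23, n00, n10, n11, n20, n21, n22, n30, n31, n32, n33, if_true, if_false]
  ring

/-- The plaquette-multiplier form of the cross integrand: `W(p) = −(1/2π)² Σ_a x_a(p) G_a(p)`. [cite: Federbush1986PhaseCellI, (3.4) p. 327, (3.11) p. 328] -/
def Wfun (ψ : E4 → Fin 4 → ℝ) (p : Fin 4 → ℝ) : ℂ :=
  -((kR : ℝ) : ℂ) * ∑ a, xLam (toC p) a * plaqSide ψ a p

/-- **The pointwise multiplier identity**: off the lattice hyperplanes,
`Σ_{μ<ν} F̌_{μν}(ψ)(p) F̂_{μν}(p) = p²(ĝ·Ψ) − (p·ĝ)(p·Ψ) = (1/2π)² p² A′·Ψ = (1/2π)² Σ_ν Λ_ν b̂_ν Ψ_ν = −(1/2π)² Σ_a x_a G_a`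
(Landau gauge `p·A′ = 0`, the gauge parts drop; `p²A′ = Λb̂`; `Λ` a co-boundary). [cite: Federbush1986PhaseCellI, (3.4) p. 327,
(3.11)–(3.12) p. 328; FederbushWilliamson1987PhaseCellII, (2.1)–(2.4) p. 1417] -/
theorem crossIntegrand_eq_Wfun (s : ℕ) (hψ : ContDiff ℝ ∞ ψ) (hsupp : HasCompactSupport ψ) {p : Fin 4 → ℝ}
    (hp : ∀ k (m : ℤ), p k ≠ 2 * Real.pi * m) : crossIntegrand s ψ p = Wfun ψ p := by
  have hp0 : ∀ k, p k ≠ 0 := fun k h => hp k 0 (by simpa using h)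
  have hpC : ∀ i, toC p i ≠ 0 := fun i => by rw [toC_apply]; exact_mod_cast hp0 i
  have hterm : ∀ μ ν : Fin 4, hatE (fun x => ((fieldStrength ψ μ ν x : ℝ) : ℂ)) p * FNhatC s μ ν (toC p)
      = ((p μ : ℂ) * tfT ψ ν p - (p ν : ℂ) * tfT ψ μ p) * ((p μ : ℂ) * ghat s ν (toC p) - (p ν : ℂ) * ghat s μ (toC p)) := by
    intro μ ν
    rw [hatE_fieldStrength hψ hsupp μ ν p, FNhatC]
    simp only [toC_apply]
    linear_combination (-(((p μ : ℂ) * tfT ψ ν p - (p ν : ℂ) * tfT ψ μ p)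
      * ((p μ : ℂ) * ghat s ν (toC p) - (p ν : ℂ) * ghat s μ (toC p)))) * Complex.I_mul_I
  unfold crossIntegrand
  simp_rw [hterm]
  rw [lagrange_fin4 (fun k => (p k : ℂ)) (fun k => tfT ψ k p) (fun k => ghat s k (toC p))]
  have hW : Wfun ψ p = ((kR : ℝ) : ℂ) * ∑ ν, Lam ν (toC p) * bondFactor ν p * tfT ψ ν p := by
    rw [Wfun, sum_Lam_bondFactor_eq ψ hp]; ring
  rw [hW]
  have hΛ : ∀ k, Lam k (toC p) * bondFactor k p = csq (toC p) * Aprime k (toC p) := fun k => (csq_mul_Aprime_eq hp k).symm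
  simp_rw [hΛ, ghat_toC_eq s _ hp]
  have hL : ∑ k, toC p k * Aprime k (toC p) = 0 := sum_coord_mul_Aprime hpC
  have hcsq : ∑ k, (p k : ℂ) ^ 2 = csq (toC p) := by simp [csq, toC_apply]
  simp only [toC_apply, Fin.sum_univ_four] at hL hcsq ⊢
  linear_combination (((kR : ℝ) : ℂ) * (tfT ψ 0 p * Aprime 0 (toC p) + tfT ψ 1 p * Aprime 1 (toC p)
      + tfT ψ 2 p * Aprime 2 (toC p) + tfT ψ 3 p * Aprime 3 (toC p))) * hcsq
    - (((kR : ℝ) : ℂ) * ((p 0 : ℂ) * tfT ψ 0 p + (p 1 : ℂ) * tfT ψ 1 p + (p 2 : ℂ) * tfT ψ 2 p + (p 3 : ℂ) * tfT ψ 3 p)) * hL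

/-- **The lattice sum of the multiplier form vanishes** for a constraint-preserving test field (off the lattice hyperplanes):
`Σ_n W(p + 2πn) = −(1/2π)² Σ_a x_a(p) Σ_n G_a(p + 2πn) = 0` (`x_a` periodic; Poisson). [cite: Federbush1986PhaseCellI, (3.4) p. 327, (3.6)–(3.7) p. 327, (3.11) p. 328] -/
theorem tsum_Wfun_shiftR_eq_zero (hψ : ContDiff ℝ ∞ ψ) (hsupp : HasCompactSupport ψ)
    (hplaq : ∀ q : Plaq 0, plaqFunctional 0 ψ q = 0) {p : Fin 4 → ℝ} (hp : ∀ k (m : ℤ), p k ≠ 2 * Real.pi * m) :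
    ∑' n : Fin 4 → ℤ, Wfun ψ (shiftR p n) = 0 := by
  have h1 : ∀ n : Fin 4 → ℤ, Wfun ψ (shiftR p n) = ∑ a, (-((kR : ℝ) : ℂ) * xLam (toC p) a) * plaqSide ψ a (shiftR p n) := by
    intro n
    rw [Wfun, toC_shiftR, xLam_shift, Finset.mul_sum]
    exact Finset.sum_congr rfl fun a _ => by ring
  simp_rw [h1]
  rw [Summable.tsum_finsetSum (fun a _ => (summable_plaqSide_shiftR hψ hsupp a hp).mul_left _)]
  refine Finset.sum_eq_zero fun a _ => ?_
  rw [tsum_mul_left, show ∑' n : Fin 4 → ℤ, plaqSide ψ a (shiftR p n) = perSum (plaqSide ψ a) p from rfl,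
    perSum_plaqSide_eq_zero hψ hsupp hplaq a hp, mul_zero]

/-- **THE CROSS TERM VANISHES**: for every smooth compactly supported test field `ψ` all of whose level-0 plaquette
variables `(χ_q, ψ)` vanish, `∫ d⁴x Σ_{μ<ν} F_{μν}(A^N)(x) F_{μν}(ψ)(x) = 0` — the weak Euler–Lagrange equation of the
constrained minimisation (3.4) at the explicit field `A^N = field s`. [cite: Federbush1986PhaseCellI, §3 p. 327 («minimizing
the continuum action subject to this constraint»), (3.4) p. 327, (3.11)–(3.12) p. 328] -/
theorem integral_crossDensity_field_eq_zero (s : ℕ) (hψ : ContDiff ℝ ∞ ψ) (hsupp : HasCompactSupport ψ)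
    (hplaq : ∀ q : Plaq 0, plaqFunctional 0 ψ q = 0) : ∫ x, crossDensity (field s) ψ x = 0 := by
  rw [integral_crossDensity_eq s hψ hsupp]
  have hae : crossIntegrand s ψ =ᵐ[volume] Wfun ψ := by
    filter_upwards [ae_off_lattice] with p hp
    exact crossIntegrand_eq_Wfun s hψ hsupp hp
  have hWint : Integrable (Wfun ψ) := (integrable_crossIntegrand s hψ hsupp).congr hae
  rw [integral_congr_ae hae, integral_eq_integral_cell_tsum hWint]
  have hae2 : ∀ᵐ p : Fin 4 → ℝ, p ∈ cell → ∑' n : Fin 4 → ℤ, Wfun ψ (shiftR p n) = 0 := by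
    filter_upwards [ae_off_lattice] with p hp _
    exact tsum_Wfun_shiftR_eq_zero hψ hsupp hplaq hp
  have hcell : MeasurableSet cell := MeasurableSet.univ_pi fun _ => measurableSet_Ico
  rw [setIntegral_congr_ae hcell hae2]
  simp

/-! ## §7 Finite action of `A^N` and the action inequality against constraint-preserving test variations -/

/-- `e^{−at} ≤ max(1, 5/a)⁵ (1 + t)⁻⁵` for `t ≥ 0`, `a > 0` (from `1 + x ≤ eˣ`). [folklore] -/
private theorem exp_neg_mul_le {a : ℝ} (ha : 0 < a) {t : ℝ} (ht : 0 ≤ t) :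
    Real.exp (-(a * t)) ≤ (max 1 (5 / a)) ^ 5 * ((1 + t) ^ 5)⁻¹ := by
  set m : ℝ := max 1 (5 / a) with hm
  have hm1 : 1 ≤ m := le_max_left _ _
  have hma : 5 / a ≤ m := le_max_right _ _
  -- (1 + at/5)^5 ≤ e^{at}
  have h1 : (1 + a * t / 5) ^ 5 ≤ Real.exp (a * t) := by
    have h := Real.add_one_le_exp (a * t / 5)
    have h' : (1 + a * t / 5) ^ 5 ≤ Real.exp (a * t / 5) ^ 5 :=
      pow_le_pow_left₀ (by positivity) (by linarith) 5
    rw [← Real.exp_nat_mul] at h'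
    have e : ((5 : ℕ) : ℝ) * (a * t / 5) = a * t := by push_cast; ring
    rwa [e] at h'
  -- (1 + t) ≤ m (1 + at/5)
  have h2 : 1 + t ≤ m * (1 + a * t / 5) := by
    have : t ≤ m * (a * t / 5) := by
      have h5 : t = (5 / a) * (a * t / 5) := by field_simp
      calc t = (5 / a) * (a * t / 5) := h5
        _ ≤ m * (a * t / 5) := mul_le_mul_of_nonneg_right hma (by positivity)
    nlinarith
  have h3 : (1 + t) ^ 5 ≤ m ^ 5 * Real.exp (a * t) := by
    calc (1 + t) ^ 5 ≤ (m * (1 + a * t / 5)) ^ 5 := pow_le_pow_left₀ (by positivity) h2 5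
      _ = m ^ 5 * (1 + a * t / 5) ^ 5 := by ring
      _ ≤ m ^ 5 * Real.exp (a * t) := mul_le_mul_of_nonneg_left h1 (by positivity)
  have hpos : 0 < (1 + t) ^ 5 := by positivity
  rw [Real.exp_neg, ← div_eq_mul_inv, le_div_iff₀ hpos, inv_mul_le_iff₀ (Real.exp_pos _)]
  linarith

/-- **`x ↦ e^{−a|x|}` is integrable on `ℝ⁴`** (`a > 0`; domination by `(1 + |x|)⁻⁵`, Mathlib's `integrable_one_add_norm`).
[folklore] -/
private theorem integrable_exp_neg_mul_norm {a : ℝ} (ha : 0 < a) : Integrable fun x : E4 => Real.exp (-(a * ‖x‖)) := by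
  have hdim : (Module.finrank ℝ E4 : ℝ) < 5 := by
    rw [finrank_euclideanSpace, Fintype.card_fin]; norm_num
  have hI := (integrable_one_add_norm (E := E4) (μ := volume) hdim).const_mul ((max 1 (5 / a)) ^ 5)
  refine hI.mono' (by fun_prop) (ae_of_all _ fun x => ?_)
  rw [Real.norm_eq_abs, abs_of_pos (Real.exp_pos _)]
  have h := exp_neg_mul_le ha (norm_nonneg x)
  have e : ((1 + ‖x‖) ^ 5)⁻¹ = (1 + ‖x‖) ^ (-(5 : ℝ)) := by
    rw [Real.rpow_neg (by positivity), ← Real.rpow_natCast]; norm_num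
  rwa [e] at h

/-- **A field with the decay package (3.13)–(3.15) has FINITE continuum action** (exponential envelope of the field strength;
`LatticeActionLimit.contAction_eq_ofReal_integral`). [cite: Federbush1986PhaseCellI, (3.13)–(3.14) p. 328, §4 p. 329] -/
theorem contAction_ne_top_of_decay313to315 {A : E4 → Fin 4 → ℝ} (h : AbelianAveraging.Decay313to315 A) :
    contAction A ≠ ⊤ := by
  obtain ⟨c, hc, γ, hγ, -, hA, -, hpd, -⟩ := h
  set g : ℝ → ℝ := fun t => 2 * c * Real.exp (-(γ * t)) with hg
  have hga : Antitone g := by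
    intro t₁ t₂ h12
    simp only [hg]
    exact mul_le_mul_of_nonneg_left (Real.exp_le_exp.2 (by nlinarith)) (by positivity)
  have hdom : ∀ y μ ν, |fieldStrength A μ ν y| ≤ g ‖y‖ := by
    intro y μ ν
    have h1 := (hpd y μ ν).le
    have h2 := (hpd y ν μ).le
    have e : ∀ z : E4, c * Real.exp (-γ * ‖z‖) = c * Real.exp (-(γ * ‖z‖)) := fun z => by ring_nf
    rw [e] at h1 h2
    unfold fieldStrength
    calc |pd A μ ν y - pd A ν μ y| ≤ |pd A μ ν y| + |pd A ν μ y| := abs_sub _ _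
      _ ≤ 2 * c * Real.exp (-(γ * ‖y‖)) := by linarith
  have hint : Integrable fun x : E4 => g (‖x‖ - 6) ^ 2 := by
    have h2γ : 0 < 2 * γ := by linarith
    have hI := (integrable_exp_neg_mul_norm h2γ).const_mul ((2 * c) ^ 2 * Real.exp (12 * γ))
    refine hI.congr (ae_of_all _ fun x => ?_)
    simp only [hg]
    have e2 : Real.exp (-(γ * (‖x‖ - 6))) ^ 2 = Real.exp (12 * γ) * Real.exp (-(2 * γ * ‖x‖)) := by
      rw [sq, ← Real.exp_add, ← Real.exp_add]; congr 1; ring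
    rw [mul_pow (2 * c), e2]
    ring
  rw [contAction_eq_ofReal_integral hA hga hdom hint]
  exact ENNReal.ofReal_ne_top

/-- `A^N = field s` has finite continuum action. [cite: Federbush1986PhaseCellI, (3.13)–(3.14) p. 328, §3 p. 327] -/
theorem contAction_field_ne_top (s : ℕ) : contAction (field s) ≠ ⊤ :=
  contAction_ne_top_of_decay313to315 (decay313to315_field s)

/-- A smooth compactly supported test field is `C¹` and has finite action. [cite: Federbush1986PhaseCellI, §0 p. 320] -/
theorem contAction_test_ne_top (hψ : ContDiff ℝ ∞ ψ) (hsupp : HasCompactSupport ψ) : contAction ψ ≠ ⊤ := by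
  obtain ⟨R, hR⟩ := (hsupp.isCompact.isBounded).subset_closedBall 0
  refine (BondRealization.contAction_lt_top_of_eq_zero_far (hψ.of_le (by norm_num)) (R := R) fun x hx => ?_).ne
  apply image_eq_zero_of_notMem_tsupport
  intro hmem
  have h := hR hmem
  rw [Metric.mem_closedBall, dist_zero_right] at h
  linarith

/-- **THE ACTION INEQUALITY (polarisation form)**: for a smooth compactly supported `ψ` with all level-0 plaquette variables
zero, `S(A^N + ψ) = S(A^N) + S(ψ)` as real numbers — hence `S(A^N) ≤ S(A^N + ψ)`. [cite: Federbush1986PhaseCellI, §3 p. 327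
(«minimizing the continuum action subject to this constraint»), (3.4) p. 327] -/
theorem toReal_contAction_field_add (s : ℕ) (hψ : ContDiff ℝ ∞ ψ) (hsupp : HasCompactSupport ψ)
    (hplaq : ∀ q : Plaq 0, plaqFunctional 0 ψ q = 0) :
    (contAction (field s + ψ)).toReal = (contAction (field s)).toReal + (contAction ψ).toReal := by
  have h := ModeLinearity.toReal_contAction_add (contDiff_field s) (hψ.of_le (by norm_num)) (contAction_field_ne_top s)
    (contAction_test_ne_top hψ hsupp)
  rw [integral_crossDensity_field_eq_zero s hψ hsupp hplaq, mul_zero, add_zero] at h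
  exact h

/-- **MINIMALITY OF `A^N` AGAINST CONSTRAINT-PRESERVING TEST VARIATIONS** — the third clause of I §3 p. 327 («minimizing the
continuum action subject to this constraint», (3.4) with α → ∞) for the explicit field `field s` and every competitor
`A^N + ψ`, `ψ ∈ C_c^∞(ℝ⁴; ℝ⁴)` with `(χ_q, ψ) = 0` for all `q ∈ ℒ⁰`: `S(A^N) ≤ S(A^N + ψ)`.
HONEST SCOPE: competitors differing from `A^N` by a general `C¹` field (the full hypothesis `hmin` of
`modeEstimatesLe_of_field_minimal`) are NOT covered here. [cite: Federbush1986PhaseCellI, §3 p. 327, (3.4) p. 327, §0 p. 320] -/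
theorem contAction_field_le_add_test (s : ℕ) (hψ : ContDiff ℝ ∞ ψ) (hsupp : HasCompactSupport ψ)
    (hplaq : ∀ q : Plaq 0, plaqFunctional 0 ψ q = 0) : contAction (field s) ≤ contAction (field s + ψ) := by
  have hψ1 : ContDiff ℝ 1 ψ := hψ.of_le (by norm_num)
  have hfin : contAction (field s + ψ) ≠ ⊤ :=
    ModeLinearity.contAction_add_ne_top (contDiff_field s) hψ1 (contAction_field_ne_top s) (contAction_test_ne_top hψ hsupp)
  rw [← ENNReal.toReal_le_toReal (contAction_field_ne_top s) hfin, toReal_contAction_field_add s hψ hsupp hplaq]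
  exact le_add_of_nonneg_right ENNReal.toReal_nonneg

/-- Plaquette variables are additive in the bond variables. [cite: Federbush1986PhaseCellI, (1.4) p. 322] -/
private theorem plaqOfBonds_add {r : ℕ} (b₁ b₂ : Edge r → ℝ) (q : Plaq r) :
    plaqOfBonds (b₁ + b₂) q = plaqOfBonds b₁ q + plaqOfBonds b₂ q := by
  simp only [plaqOfBonds, Pi.add_apply]; ring

/-- **The hypothesis `hmin` of `modeEstimatesLe_of_field_minimal`, DISCHARGED FOR TEST-FIELD COMPETITORS**: every competitor
`A' = A^N + ψ` with `ψ ∈ C_c^∞` and the same level-0 plaquette variables (in the tree's Bałaban averaging `axialTreeAveraging`)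
has at least the continuum action of `A^N`.  (The general `C¹` competitor of `hmin` is not covered — see the module docstring.)
[cite: Federbush1986PhaseCellI, §0 p. 320 («minimizing the continuum action subject to this constraint»), §3 p. 327, (3.4) p. 327] -/
theorem contAction_field_le_of_plaq_eq (s : ℕ) (hψ : ContDiff ℝ ∞ ψ) (hsupp : HasCompactSupport ψ)
    (hplaq : ∀ q : Plaq 0, axialTreeAveraging.plaq 0 (field s + ψ) q = axialTreeAveraging.plaq 0 (field s) q) :
    contAction (field s) ≤ contAction (field s + ψ) := by
  have hψ1 : ContDiff ℝ 1 ψ := hψ.of_le (by norm_num)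
  refine contAction_field_le_add_test s hψ hsupp fun q => ?_
  have h := hplaq q
  simp only [AbelianAveraging.plaq, ModeLinearity.bond_add (contDiff_field s) hψ1, plaqOfBonds_add] at h
  have h0 : plaqOfBonds (axialTreeAveraging.bond 0 ψ) q = 0 := by linarith
  rw [← axialTreeAveraging_plaq_eq_plaqFunctional hψ1 0 q]
  exact h0

end CorrectedMode


end

end Literature.MathematicalPhysics.QuantumFieldTheory.Federbush1986
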